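import Literature.Probability.LatticeModels.MessagerMiracleSole
import Mathlib.Analysis.SpecialFunctions.Exponential
import Mathlib.Analysis.Calculus.Deriv.MeanValue
import Mathlib.Analysis.Calculus.Deriv.Inv
import HarnessLib

/-!
# Lebowitz' inequality for the Ising model and the boundary inequality for two-point functions

Trunk G02 (T-STATMECH), topic `Probability/LatticeModels`, namespace `Literature.StatMech`. Sorry-free
proof, for the spin system `ν_{Λ;K}` of `GKSInequalities` (Friedli–Velenik 2017, §3.8.1) with
nonnegative couplings supported on **at most two sites** (pair interactions and fields — the
finite-volume Ising model with free or `+` boundary condition and `h ≥ 0` is of this form,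
`isingCorr_eq_gksExpect`), of

* **Lebowitz' inequality** (Lebowitz, *GHS and other inequalities*, Comm. Math. Phys. **35**
  (1974) 87–92, Theorem, eq. (2.5b): `⟨q_At_B⟩ ≤ ⟨q_A⟩⟨t_B⟩` for `h ≥ 0`, there from GKS and the
  lattice FKG inequality; here in the form and with the fourfold-replica proof of Glimm–Jaffe,
  *Quantum Physics*, 2nd ed. (1987), §4.3, Thm. 4.3.1 and Cor. 4.3.2, third inequality): in the
  duplicated system with `t = σ + σ'`, `q = σ - σ'`, `⟨t_zt_y q_aq_x⟩ ≤ ⟨t_zt_y⟩⟨q_aq_x⟩`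
  (`lebowitz_pair`, the case `|A| = |B| = 2`);
* its consequence on covariances of pair observables,
  `⟨σ_aσ_z σ_xσ_y⟩ - ⟨σ_aσ_z⟩⟨σ_xσ_y⟩ ≤ 2(⟨σ_aσ_x⟩⟨σ_yσ_z⟩ + ⟨σ_aσ_y⟩⟨σ_xσ_z⟩)`
  (`gksExpect_cov_spinPair_le`; cf. Glimm–Jaffe 1987, Cor. 4.3.3 and §17.5–17.6, "the derivatives
  are bounded from above by sums of products of two-point functions");
* the **boundary inequality** obtained by switching on the couplings of a set `B` of bonds
  `{xᵢ, yᵢ}` from `0` to their value (`gksExpect_spinPair_le_boundary_sum`): if with the bonds of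
  `B` removed `⟨σ_aσ_z⟩ = 0` by a spin-flip symmetry, then
  `⟨σ_aσ_z⟩ ≤ ∑_{i∈B} Kᵢ · 2(⟨σ_aσ_{xᵢ}⟩⟨σ_{yᵢ}σ_z⟩ + ⟨σ_aσ_{yᵢ}⟩⟨σ_{xᵢ}σ_z⟩)`
  (derivative = sum of covariances, Glimm–Jaffe 1987, Prop. 4.2.1; Lebowitz bound; Griffiths'
  monotonicity in the couplings; mean value inequality on `[0,1]`);
* its **Ising form** on a locally finite graph (`isingTwoPoint_le_boundary_sum`): free or `+`
  boundary condition, `β ≥ 0`, zero field, `S ⊆ Λ` with all neighbours of `S` in `Λ`, `a ∈ S`,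
  `z ∈ Λ ∖ S`:
  `⟨σ_aσ_z⟩_Λ ≤ 2β ∑_{x∈S} ∑_{y∼x, y∉S} (⟨σ_aσ_x⟩_Λ⟨σ_yσ_z⟩_Λ + ⟨σ_aσ_y⟩_Λ⟨σ_xσ_z⟩_Λ)`.

The last inequality is a finite-boundary decay criterion of the same type as Simon's inequality
(B. Simon, Comm. Math. Phys. 77 (1980) 111–126), Lieb's refinement (E. H. Lieb, ibid. 127–135)
and the modified Simon inequality of Duminil-Copin–Tassion (Comm. Math. Phys. 343 (2016), Lemma
2.7), with `2βJ` in place of `tanh(βJ)` and full-volume `⟨σ_aσ_x⟩_Λ` in place of `⟨σ_aσ_x⟩_S`;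
unlike those it needs neither Simon's graphical expansion nor random currents, only Lebowitz'
inequality, and it suffices for the argument "`φ_β(Λ_n) < 1 ⇒` exponential decay" in
Duminil-Copin 2019, proof of Thm. 4.8 (used downstream in `SharpnessProofs`, Part III).

## Method (Glimm–Jaffe 1987, §4.1 and §4.3, for spin `½`)

1. `classExp_step`, `classExp_sum_mul_exp_sum_nonneg` — the first Griffiths inequality for a
   product-closed class of observables, with the exponential expanded in its **power series**
   (`HasSum`), so that no restriction on the values of the observables is needed (Glimm–Jaffe
   1987, proof of Thm. 4.1.1).
2. The fourfold replicated system `(ξ, χ, ξ', χ')` (`Cfg4`) and the rotated variables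
   `A = ξ+χ+ξ'+χ'`, `B = ξ+χ-ξ'-χ'`, `C = ξ-χ+ξ'-χ'`, `D = -ξ+χ+ξ'-χ'` (`repA`–`repD`; twice the
   `α, β, γ, δ` of Glimm–Jaffe (4.3.2)); the monomials `∏_x A_x^k B_x^l C_x^m D_x^n`
   (`repMonomial`, `repClass`); positivity of their a-priori sums (`sum_repMonomial_nonneg`, the
   spin-`½` case of (4.3.6): by the site-wise sign symmetries `repNeg`, `repSwap₁`, `repSwap₂` the
   sum vanishes unless all four exponents at each site have the same parity, and
   `A_xB_xC_xD_x ≥ 0` pointwise); the orthogonality of the rotation,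
   `∑_replicas σ_xσ_y = ¼(A_xA_y + B_xB_y + C_xC_y + D_xD_y)` (`quadSum_pair`, (4.3.5)); hence the
   replicated Gibbs weight is positive on the class (`sum_repClass_mul_gksWeight4_nonneg`,
   Thm. 4.3.1) — this is where the restriction to supports of at most two sites enters.
3. `lebowitz_pair`: `⟨t^Aq^B⟩ ≤ ⟨t^A⟩⟨q^B⟩` is `∑_c t^A(ξ,χ)[q^B(ξ',χ') - q^B(ξ,χ)] w⁴ ≥ 0`, and
   `T_zT_y = ¼(A+B)_z(A+B)_y`, `Q'_aQ'_x - Q_aQ_x = ½(C_aD_x + D_aC_x)` (Cor. 4.3.2).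
4. `cov_spinPair_eq_gksSum2` (`Z²Cov = ⅛∑∑(T_zT_yQ_aQ_x + …) ww`), `gksSum2_ttqq_le` (Lebowitz +
   GKS II: `∑∑T_uT_v ww ≤ 4Z·Z⟨σ_uσ_v⟩`, `0 ≤ ∑∑Q_pQ_r ww ≤ 2Z·Z⟨σ_pσ_r⟩`),
   `gksExpect_cov_spinPair_le`.
5. `cplAt`/`cplOn`/`cplOff`, `hasDerivAt_gksSum_cplAt`, `hasDerivAt_gksExpect_cplAt_cov`
   (Prop. 4.2.1), the spin flip `flipOn` of `MessagerMiracleSole` (imported for it),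
   `gksSum_spinPair_eq_zero_of_even`, `gksExpect_spinPair_le_boundary_sum`
   (`Convex.image_sub_le_mul_sub_of_deriv_le` on `[0,1]`).
6. `isingTwoPoint_eq_gksExpect`, `card_isingSupp_le_two`, `bdryPairs`,
   `isingTwoPoint_le_boundary_sum`.

## Faithfulness notes

* Glimm–Jaffe prove Thm. 4.3.1 for single-spin measures `e^{-λξ⁴-σξ²}dξ` ("The general case
  follows by limits"); for `σ = ±1` the single-site positivity (4.3.6) is checked directly here
  (`sum_repMonomial_nonneg`), which is Lebowitz' original setting (Lebowitz 1974; Ellis–Monroe–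
  Newman 1976 for the general class of single-spin measures).
* Only the degree-`(2,2)` case of Cor. 4.3.2 needed downstream is stated; the class positivity
  `sum_repClass_mul_gksWeight4_nonneg` is general.
* The boundary inequality is not claimed to be any of the printed Simon/Lieb/DCT inequalities; its
  docstring says what it is and cites the ingredients.

## Relation to the tree

* The pair observable is the tree's `spinPair u v = σ_uσ_v` (`Correlations`); the spin flip is
  `flipOn` (`MessagerMiracleSole`).
* The tree's named fact `Literature.Probability.LatticeModels.lebowitz` (`CorrelationInequalities`, crit-ising.S19:
  `U₄ ≤ 0` at `h = 0`, free boundary condition) is **not** discharged here; at `h = 0` (odd moments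
  vanish) `lebowitz_pair` reads `Z·Z⟨σ_zσ_yσ_aσ_x⟩ + (Z⟨σ_zσ_y⟩)(Z⟨σ_aσ_x⟩) - (Z⟨σ_zσ_a⟩)(Z⟨σ_yσ_x⟩) -
  (Z⟨σ_zσ_x⟩)(Z⟨σ_yσ_a⟩) ≤ 2(Z⟨σ_zσ_y⟩)(Z⟨σ_aσ_x⟩)`, i.e. `U₄(z,y,a,x) ≤ 0`, so a later
  `lebowitz_holds` can be derived from this file; see also `ursellFour_eq_doubleCurrent.nonpos`
  (`UrsellFourCurrents`, from the random-current identity).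
* A sibling finite-boundary decay criterion, the modified Simon inequality of
  Duminil-Copin–Tassion (via the switching lemma), is `ModifiedSimonInequality`.

## Mathlib status

Mathlib has no correlation inequalities for spin systems (searched `Lebowitz`, `GHS`, `Griffiths`,
`Ising`). Anchors: `NormedSpace.expSeries_div_hasSum_exp`, `Real.exp_eq_exp_ℝ`, `hasSum_sum`,
`HasSum.mul_left/right`, `HasSum.nonneg`, `Fintype.sum_bijective`, `Fintype.sum_prod_type`,
`Finset.sum_mul_sum`, `Finset.sum_comm`, `Finset.card_eq_two`, `Finset.prod_pair`,
`hasDerivAt_mul_const`, `HasDerivAt.exp`, `HasDerivAt.fun_sum`, `HasDerivAt.div`,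
`HasDerivAt.deriv`, `Convex.image_sub_le_mul_sub_of_deriv_le`, `interior_Icc`,
`Finset.sum_image`, `Set.InjOn`, `Sym2.eq_iff`, `choose`; tree anchors `spinPair`,
`measurable_spinPair` (`Correlations`), `flipOn`, `spinAt_flipOn`, `flipOn_involutive`
(`MessagerMiracleSole`), and from `GKSInequalities`:
`gksSum`, `gksExpect`, `gksWeight`, `gksSum_spinProduct_nonneg`, `gksSum_mul_gksSum_le`,
`gksExpect_mono_of_abs_le`, `spinProduct_mul_eq_spinProduct_symmDiff`, `isingIdx`,
`gksCoupling`, `isingSupp`, `gksCoupling_nonneg`, `isingWeight_eq_gksWeight`,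
`spinAt_glue_of_mem`, `edgeCoeff_of_mem_edgesIn`, `gksCoupling_plus_inl`.

## References

* J. L. Lebowitz, *GHS and other inequalities*, Comm. Math. Phys. 35 (1974) 87–92,
  doi:10.1007/bf01646608 [Lebowitz1974].
* J. Glimm, A. Jaffe, *Quantum Physics: A Functional Integral Point of View*, 2nd ed., Springer
  (1987), §4.1 (Thm. 4.1.1, Lemma 4.1.2, Thm. 4.1.3), §4.2 (Prop. 4.2.1), §4.3 (Thm. 4.3.1,
  Cor. 4.3.2, Cor. 4.3.3) [GlimmJaffe1987].
* R. S. Ellis, J. L. Monroe, C. M. Newman, *The GHS and other correlation inequalities for a class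
  of even ferromagnets*, Comm. Math. Phys. 46 (1976) 167–182 [EllisMonroeNewman1976].
* S. Friedli, Y. Velenik, *Statistical Mechanics of Lattice Systems*, CUP (2017), §3.8.1
  [FriedliVelenik2017].
* B. Simon, *Correlation inequalities and the decay of correlations in ferromagnets*, Comm. Math.
  Phys. 77 (1980) 111–126; E. H. Lieb, *A refinement of Simon's correlation inequality*, ibid.
  127–135 (context for the boundary inequality).
-/

noncomputable section

open Finset
open scoped symmDiff

namespace Literature.Probability.LatticeModels

/-! ### First Griffiths inequality for a product-closed class, via the exponential series -/

section ClassExp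

variable {Ω : Type*} [Fintype Ω]

/-- One step of the first Griffiths inequality for a class `𝓜` of observables closed under
products, with no restriction on their values: if `∑ M W ≥ 0` for all `M ∈ 𝓜`, then
`∑ M e^{aN} W ≥ 0` for `a ≥ 0`, `N ∈ 𝓜`. Proof: expand `e^{aN} = ∑ₙ (aN)ⁿ/n!` (Glimm–Jaffe 1987,
proof of Thm. 4.1.1, "We expand the exponent … in a Taylor's series"); every term is
`aⁿ/n! ∑ (M Nⁿ) W ≥ 0`. [cite: GlimmJaffe1987, proof of Thm. 4.1.1] -/
theorem classExp_step {𝓜 : Set (Ω → ℝ)} (hmul : ∀ M ∈ 𝓜, ∀ N ∈ 𝓜, M * N ∈ 𝓜)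
    {W : Ω → ℝ} (hW : ∀ M ∈ 𝓜, 0 ≤ ∑ ω, M ω * W ω) {a : ℝ} (ha : 0 ≤ a) {N : Ω → ℝ}
    (hN : N ∈ 𝓜) : ∀ M ∈ 𝓜, 0 ≤ ∑ ω, M ω * (Real.exp (a * N ω) * W ω) := by
  intro M hM
  have hpow : ∀ n : ℕ, M * N ^ n ∈ 𝓜 := by
    intro n
    induction n with
    | zero => simpa using hM
    | succ n ih =>
      have h := hmul _ ih N hN
      rwa [pow_succ, ← mul_assoc]
  have hsum : HasSum (fun n : ℕ => ∑ ω, M ω * ((a * N ω) ^ n / (n.factorial : ℝ) * W ω))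
      (∑ ω, M ω * (Real.exp (a * N ω) * W ω)) := by
    refine hasSum_sum fun ω _ => ?_
    refine HasSum.mul_left (M ω) (HasSum.mul_right (W ω) ?_)
    rw [Real.exp_eq_exp_ℝ]
    exact NormedSpace.expSeries_div_hasSum_exp (a * N ω)
  refine hsum.nonneg fun n => ?_
  have h : ∑ ω, M ω * ((a * N ω) ^ n / (n.factorial : ℝ) * W ω) =
      a ^ n / (n.factorial : ℝ) * ∑ ω, (M * N ^ n) ω * W ω := by
    rw [Finset.mul_sum]
    refine Finset.sum_congr rfl fun ω _ => ?_
    simp only [Pi.mul_apply, Pi.pow_apply, mul_pow]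
    ring
  rw [h]
  exact mul_nonneg (div_nonneg (pow_nonneg ha n) (Nat.cast_nonneg _)) (hW _ (hpow n))

/-- **First Griffiths inequality for a product-closed class** (weighted form): if `∑ M W ≥ 0` for
all `M` in a class `𝓜` closed under products, then `∑_ω M(ω) exp(∑ⱼ aⱼ Nⱼ(ω)) W(ω) ≥ 0` for
`aⱼ ≥ 0`, `Nⱼ ∈ 𝓜`, `M ∈ 𝓜` (Glimm–Jaffe 1987, proof of Thms. 4.1.1 and 4.3.1: "expand the
exponent … and factor over lattice sites"; induction on the number of terms). [cite: GlimmJaffe1987, proof of Thm. 4.3.1] -/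
theorem classExp_sum_mul_exp_sum_nonneg {𝓜 : Set (Ω → ℝ)}
    (hmul : ∀ M ∈ 𝓜, ∀ N ∈ 𝓜, M * N ∈ 𝓜) {W : Ω → ℝ} (hW : ∀ M ∈ 𝓜, 0 ≤ ∑ ω, M ω * W ω)
    {κ : Type*} (s : Finset κ) (a : κ → ℝ) (N : κ → Ω → ℝ) (ha : ∀ j ∈ s, 0 ≤ a j)
    (hN : ∀ j ∈ s, N j ∈ 𝓜) :
    ∀ M ∈ 𝓜, 0 ≤ ∑ ω, M ω * (Real.exp (∑ j ∈ s, a j * N j ω) * W ω) := by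
  classical
  induction s using Finset.induction_on with
  | empty =>
    intro M hM
    simpa using hW M hM
  | insert j s hj ih =>
    intro M hM
    have ih' := ih (fun i hi => ha i (Finset.mem_insert_of_mem hi))
      (fun i hi => hN i (Finset.mem_insert_of_mem hi))
    have h := classExp_step hmul ih' (ha j (Finset.mem_insert_self j s))
      (hN j (Finset.mem_insert_self j s)) M hM
    have hexp : ∀ ω, Real.exp (∑ i ∈ insert j s, a i * N i ω) * W ω =
        Real.exp (a j * N j ω) * (Real.exp (∑ i ∈ s, a i * N i ω) * W ω) := by
      intro ω
      rw [Finset.sum_insert hj, Real.exp_add, mul_assoc]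
    simp_rw [hexp]
    exact h

end ClassExp

/-! ### The fourfold replicated system and the rotated variables -/

section Replica

variable {Λ : Type*}

/-- A configuration of the fourfold replicated system `(ξ, χ, ξ', χ')` (Glimm–Jaffe 1987, §4.3,
"we introduce new variables `ξ', χ'`" on top of the duplicate variables `ξ, χ` of §4.1). [cite: GlimmJaffe1987, §4.3, eq. (4.3.2)] -/
abbrev Cfg4 (Λ : Type*) := SpinConfig Λ × SpinConfig Λ × SpinConfig Λ × SpinConfig Λ

/-- `A_x = ξ_x + χ_x + ξ'_x + χ'_x = 2α_x` in the notation of Glimm–Jaffe 1987, eq. (4.3.2)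
(`α = 2^{-1/2}(t + t')`, `t = 2^{-1/2}(ξ + χ)`); we work with the unnormalised integer
combinations. [cite: GlimmJaffe1987, §4.3, eq. (4.3.2)] -/
def repA (x : Λ) (c : Cfg4 Λ) : ℝ :=
  spinAt x c.1 + spinAt x c.2.1 + spinAt x c.2.2.1 + spinAt x c.2.2.2

/-- `B_x = ξ_x + χ_x - ξ'_x - χ'_x = 2β_x` (Glimm–Jaffe 1987, eq. (4.3.2), `β = 2^{-1/2}(t - t')`). [cite: GlimmJaffe1987, §4.3, eq. (4.3.2)] -/
def repB (x : Λ) (c : Cfg4 Λ) : ℝ :=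
  spinAt x c.1 + spinAt x c.2.1 - spinAt x c.2.2.1 - spinAt x c.2.2.2

/-- `C_x = ξ_x - χ_x + ξ'_x - χ'_x = 2γ_x` (Glimm–Jaffe 1987, eq. (4.3.2), `γ = 2^{-1/2}(q + q')`,
`q = 2^{-1/2}(ξ - χ)`). [cite: GlimmJaffe1987, §4.3, eq. (4.3.2)] -/
def repC (x : Λ) (c : Cfg4 Λ) : ℝ :=
  spinAt x c.1 - spinAt x c.2.1 + spinAt x c.2.2.1 - spinAt x c.2.2.2

/-- `D_x = -ξ_x + χ_x + ξ'_x - χ'_x = 2δ_x` (Glimm–Jaffe 1987, eq. (4.3.2), `δ = 2^{-1/2}(q' - q)`). [cite: GlimmJaffe1987, §4.3, eq. (4.3.2)] -/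
def repD (x : Λ) (c : Cfg4 Λ) : ℝ :=
  -spinAt x c.1 + spinAt x c.2.1 + spinAt x c.2.2.1 - spinAt x c.2.2.2

variable [Fintype Λ]

/-- The monomials `∏_x A_x^{k_x} B_x^{l_x} C_x^{m_x} D_x^{n_x}` in the rotated variables
(Glimm–Jaffe 1987, eq. (4.3.3): `α^A β^B γ^C δ^D`). [cite: GlimmJaffe1987, Thm. 4.3.1, eq. (4.3.3)] -/
def repMonomial (k l m n : Λ → ℕ) (c : Cfg4 Λ) : ℝ :=
  ∏ x, repA x c ^ k x * repB x c ^ l x * repC x c ^ m x * repD x c ^ n x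

/-- The class of monomials in the rotated variables. [cite: GlimmJaffe1987, Thm. 4.3.1, eq. (4.3.3)] -/
def repClass : Set (Cfg4 Λ → ℝ) :=
  {M | ∃ k l m n : Λ → ℕ, M = repMonomial k l m n}

/-- Monomials multiply by adding exponents. [folklore] -/
theorem repMonomial_mul (k l m n k' l' m' n' : Λ → ℕ) :
    repMonomial k l m n * repMonomial k' l' m' n' =
      repMonomial (k + k') (l + l') (m + m') (n + n') := by
  funext c
  simp only [Pi.mul_apply, repMonomial, Pi.add_apply, pow_add, ← Finset.prod_mul_distrib]
  exact Finset.prod_congr rfl fun x _ => by ring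

/-- The class of monomials is closed under products. [folklore] -/
theorem repClass_mul_mem : ∀ M ∈ (repClass : Set (Cfg4 Λ → ℝ)), ∀ N ∈ repClass, M * N ∈ repClass := by
  rintro _ ⟨k, l, m, n, rfl⟩ _ ⟨k', l', m', n', rfl⟩
  exact ⟨k + k', l + l', m + m', n + n', repMonomial_mul k l m n k' l' m' n'⟩

/-- `1` is a monomial. [folklore] -/
theorem one_mem_repClass : (fun _ => (1 : ℝ)) ∈ (repClass : Set (Cfg4 Λ → ℝ)) :=
  ⟨0, 0, 0, 0, by funext c; simp [repMonomial]⟩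

/-- Products of members (as a lambda) are members. [folklore] -/
theorem mul_mem_repClass {M N : Cfg4 Λ → ℝ} (hM : M ∈ repClass) (hN : N ∈ repClass) :
    (fun c => M c * N c) ∈ repClass :=
  repClass_mul_mem M hM N hN

/-- Finite products of members are members. [folklore] -/
theorem prod_mem_repClass {κ : Type*} (t : Finset κ) (f : κ → Cfg4 Λ → ℝ)
    (hf : ∀ j ∈ t, f j ∈ repClass) : (fun c => ∏ j ∈ t, f j c) ∈ repClass := by
  classical
  induction t using Finset.induction_on with
  | empty => simpa using one_mem_repClass
  | insert j t hj ih =>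
    have h := mul_mem_repClass (hf j (Finset.mem_insert_self j t))
      (ih fun i hi => hf i (Finset.mem_insert_of_mem hi))
    simpa only [Finset.prod_insert hj] using h

variable [DecidableEq Λ]

/-- `A_x` is a monomial. [folklore] -/
theorem repA_mem_repClass (x : Λ) : repA x ∈ (repClass : Set (Cfg4 Λ → ℝ)) :=
  ⟨fun y => if y = x then 1 else 0, 0, 0, 0, by
    funext c; simp [repMonomial, pow_ite, Finset.prod_ite_eq']⟩

/-- `B_x` is a monomial. [folklore] -/
theorem repB_mem_repClass (x : Λ) : repB x ∈ (repClass : Set (Cfg4 Λ → ℝ)) :=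
  ⟨0, fun y => if y = x then 1 else 0, 0, 0, by
    funext c; simp [repMonomial, pow_ite, Finset.prod_ite_eq']⟩

/-- `C_x` is a monomial. [folklore] -/
theorem repC_mem_repClass (x : Λ) : repC x ∈ (repClass : Set (Cfg4 Λ → ℝ)) :=
  ⟨0, 0, fun y => if y = x then 1 else 0, 0, by
    funext c; simp [repMonomial, pow_ite, Finset.prod_ite_eq']⟩

/-- `D_x` is a monomial. [folklore] -/
theorem repD_mem_repClass (x : Λ) : repD x ∈ (repClass : Set (Cfg4 Λ → ℝ)) :=
  ⟨0, 0, 0, fun y => if y = x then 1 else 0, by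
    funext c; simp [repMonomial, pow_ite, Finset.prod_ite_eq']⟩

/-! #### Sign symmetries of the a-priori measure and `∑_c M(c) ≥ 0` -/

/-- Replace the spin at `x` of `σ` by that of `τ`. [folklore] -/
def mixAt (x : Λ) (σ τ : SpinConfig Λ) : SpinConfig Λ := fun y => if y = x then τ y else σ y

omit [Fintype Λ] in
/-- Spins after `mixAt`. [folklore] -/
theorem spinAt_mixAt (x : Λ) (σ τ : SpinConfig Λ) (y : Λ) :
    spinAt y (mixAt x σ τ) = if y = x then spinAt y τ else spinAt y σ := by
  by_cases hy : y = x <;> simp [mixAt, spinAt, hy]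

/-- Negate all four replicas at the site `x` (the symmetry `ξ ↦ -ξ` of the even single-spin
measure, Glimm–Jaffe 1987, proof of Thm. 4.1.1), with the spin flip `flipOn` of
`MessagerMiracleSole`. [cite: GlimmJaffe1987, proof of Thm. 4.1.1] -/
def repNeg (x : Λ) (c : Cfg4 Λ) : Cfg4 Λ :=
  (flipOn {x} c.1, flipOn {x} c.2.1, flipOn {x} c.2.2.1, flipOn {x} c.2.2.2)

/-- Exchange `ξ_x ↔ χ_x` and `ξ'_x ↔ χ'_x` at the site `x`. [folklore] -/
def repSwap₁ (x : Λ) (c : Cfg4 Λ) : Cfg4 Λ :=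
  (mixAt x c.1 c.2.1, mixAt x c.2.1 c.1, mixAt x c.2.2.1 c.2.2.2, mixAt x c.2.2.2 c.2.2.1)

/-- Exchange `ξ_x ↔ ξ'_x` and `χ_x ↔ χ'_x` at the site `x`. [folklore] -/
def repSwap₂ (x : Λ) (c : Cfg4 Λ) : Cfg4 Λ :=
  (mixAt x c.1 c.2.2.1, mixAt x c.2.1 c.2.2.2, mixAt x c.2.2.1 c.1, mixAt x c.2.2.2 c.2.1)

omit [Fintype Λ] in
/-- `repNeg x` is an involution. [folklore] -/
theorem repNeg_involutive (x : Λ) : Function.Involutive (repNeg (Λ := Λ) x) := by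
  intro c
  obtain ⟨ξ, χ, ξ', χ'⟩ := c
  simp only [repNeg, Prod.mk.injEq]
  refine ⟨?_, ?_, ?_, ?_⟩ <;> funext y <;> by_cases hy : y = x <;> simp [flipOn, hy]

omit [Fintype Λ] in
/-- `repSwap₁ x` is an involution. [folklore] -/
theorem repSwap₁_involutive (x : Λ) : Function.Involutive (repSwap₁ (Λ := Λ) x) := by
  intro c
  obtain ⟨ξ, χ, ξ', χ'⟩ := c
  simp only [repSwap₁, Prod.mk.injEq]
  refine ⟨?_, ?_, ?_, ?_⟩ <;> funext y <;> by_cases hy : y = x <;> simp [mixAt, hy]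

omit [Fintype Λ] in
/-- `repSwap₂ x` is an involution. [folklore] -/
theorem repSwap₂_involutive (x : Λ) : Function.Involutive (repSwap₂ (Λ := Λ) x) := by
  intro c
  obtain ⟨ξ, χ, ξ', χ'⟩ := c
  simp only [repSwap₂, Prod.mk.injEq]
  refine ⟨?_, ?_, ?_, ?_⟩ <;> funext y <;> by_cases hy : y = x <;> simp [mixAt, hy]

omit [Fintype Λ] in
/-- The rotated variables under `repNeg x`: all four change sign at `x`. [folklore] -/
theorem rep_repNeg (x : Λ) (c : Cfg4 Λ) (y : Λ) :
    repA y (repNeg x c) = (if y = x then -1 else 1) * repA y c ∧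
    repB y (repNeg x c) = (if y = x then -1 else 1) * repB y c ∧
    repC y (repNeg x c) = (if y = x then -1 else 1) * repC y c ∧
    repD y (repNeg x c) = (if y = x then -1 else 1) * repD y c := by
  refine ⟨?_, ?_, ?_, ?_⟩ <;> by_cases hy : y = x <;>
    simp [repA, repB, repC, repD, repNeg, spinAt_flipOn, hy] <;> ring

omit [Fintype Λ] in
/-- The rotated variables under `repSwap₁ x`: `A, B` are invariant, `C, D` change sign at `x`. [folklore] -/
theorem rep_repSwap₁ (x : Λ) (c : Cfg4 Λ) (y : Λ) :
    repA y (repSwap₁ x c) = repA y c ∧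
    repB y (repSwap₁ x c) = repB y c ∧
    repC y (repSwap₁ x c) = (if y = x then -1 else 1) * repC y c ∧
    repD y (repSwap₁ x c) = (if y = x then -1 else 1) * repD y c := by
  refine ⟨?_, ?_, ?_, ?_⟩ <;> by_cases hy : y = x <;>
    simp [repA, repB, repC, repD, repSwap₁, spinAt_mixAt, hy] <;> ring

omit [Fintype Λ] in
/-- The rotated variables under `repSwap₂ x`: `A, C` are invariant, `B, D` change sign at `x`. [folklore] -/
theorem rep_repSwap₂ (x : Λ) (c : Cfg4 Λ) (y : Λ) :
    repA y (repSwap₂ x c) = repA y c ∧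
    repB y (repSwap₂ x c) = (if y = x then -1 else 1) * repB y c ∧
    repC y (repSwap₂ x c) = repC y c ∧
    repD y (repSwap₂ x c) = (if y = x then -1 else 1) * repD y c := by
  refine ⟨?_, ?_, ?_, ?_⟩ <;> by_cases hy : y = x <;>
    simp [repA, repB, repC, repD, repSwap₂, spinAt_mixAt, hy] <;> ring

/-- Pulling a sign attached to one site out of a product. [folklore] -/
theorem prod_ite_sign_mul (x : Λ) (s : ℝ) (f : Λ → ℝ) :
    ∏ y, (if y = x then s else 1) * f y = s * ∏ y, f y := by
  rw [Finset.prod_mul_distrib, Finset.prod_ite_eq' Finset.univ x fun _ => s, if_pos (Finset.mem_univ x)]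

/-- `repNeg x` multiplies a monomial by `(-1)^{k_x + l_x + m_x + n_x}`. [folklore] -/
theorem repMonomial_repNeg (x : Λ) (k l m n : Λ → ℕ) (c : Cfg4 Λ) :
    repMonomial k l m n (repNeg x c) = (-1) ^ (k x + l x + m x + n x) * repMonomial k l m n c := by
  unfold repMonomial
  rw [← prod_ite_sign_mul x]
  refine Finset.prod_congr rfl fun y _ => ?_
  obtain ⟨hA, hB, hC, hD⟩ := rep_repNeg x c y
  rw [hA, hB, hC, hD]
  by_cases hy : y = x
  · subst hy; simp only [if_true, mul_pow, pow_add]; ring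
  · simp only [hy, if_false, one_mul]

/-- `repSwap₁ x` multiplies a monomial by `(-1)^{m_x + n_x}`. [folklore] -/
theorem repMonomial_repSwap₁ (x : Λ) (k l m n : Λ → ℕ) (c : Cfg4 Λ) :
    repMonomial k l m n (repSwap₁ x c) = (-1) ^ (m x + n x) * repMonomial k l m n c := by
  unfold repMonomial
  rw [← prod_ite_sign_mul x]
  refine Finset.prod_congr rfl fun y _ => ?_
  obtain ⟨hA, hB, hC, hD⟩ := rep_repSwap₁ x c y
  rw [hA, hB, hC, hD]
  by_cases hy : y = x
  · subst hy; simp only [if_true, mul_pow, pow_add]; ring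
  · simp only [hy, if_false, one_mul]

/-- `repSwap₂ x` multiplies a monomial by `(-1)^{l_x + n_x}`. [folklore] -/
theorem repMonomial_repSwap₂ (x : Λ) (k l m n : Λ → ℕ) (c : Cfg4 Λ) :
    repMonomial k l m n (repSwap₂ x c) = (-1) ^ (l x + n x) * repMonomial k l m n c := by
  unfold repMonomial
  rw [← prod_ite_sign_mul x]
  refine Finset.prod_congr rfl fun y _ => ?_
  obtain ⟨hA, hB, hC, hD⟩ := rep_repSwap₂ x c y
  rw [hA, hB, hC, hD]
  by_cases hy : y = x
  · subst hy; simp only [if_true, mul_pow, pow_add]; ring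
  · simp only [hy, if_false, one_mul]

/-- A sum over the replicated configurations of an observable that is odd under an involution
vanishes. [folklore] -/
theorem sum_cfg4_eq_zero_of_odd {g : Cfg4 Λ → Cfg4 Λ} (hg : Function.Involutive g)
    (F : Cfg4 Λ → ℝ) (hF : ∀ c, F (g c) = -F c) : ∑ c, F c = 0 := by
  have h : ∑ c, F c = ∑ c, F (g c) :=
    (Fintype.sum_bijective g hg.bijective _ _ fun _ => rfl).symm
  have h2 : ∑ c, F (g c) = -∑ c, F c := by
    rw [← Finset.sum_neg_distrib]
    exact Finset.sum_congr rfl fun c _ => hF c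
  linarith

omit [Fintype Λ] [DecidableEq Λ] in
/-- `A_x B_x C_x D_x ≥ 0` pointwise: on the sixteen values of `(ξ_x, χ_x, ξ'_x, χ'_x)` the vector
`(A, B, C, D)_x` is either `±4 eᵢ` (product `0`) or `(±2, ±2, ±2, ±2)` with an even number of
minus signs (product `16`). This is the spin-`½` case of the single-site positivity
(4.3.6)–(4.3.7) of Glimm–Jaffe 1987 (there for `φ⁴` single-spin measures; for `σ = ±1` it is the
content of Lebowitz 1974). [cite: GlimmJaffe1987, proof of Thm. 4.3.1, eqs. (4.3.6)-(4.3.7)] -/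
theorem repA_mul_repB_mul_repC_mul_repD_nonneg (x : Λ) (c : Cfg4 Λ) :
    0 ≤ repA x c * repB x c * repC x c * repD x c := by
  simp only [repA, repB, repC, repD]
  rcases spinAt_eq_one_or_eq_neg_one x c.1 with h1 | h1 <;>
  rcases spinAt_eq_one_or_eq_neg_one x c.2.1 with h2 | h2 <;>
  rcases spinAt_eq_one_or_eq_neg_one x c.2.2.1 with h3 | h3 <;>
  rcases spinAt_eq_one_or_eq_neg_one x c.2.2.2 with h4 | h4 <;>
  rw [h1, h2, h3, h4] <;> norm_num

/-- **Positivity of the a-priori moments of the rotated variables**: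
`∑_{(ξ,χ,ξ',χ')} ∏_x A_x^{k_x} B_x^{l_x} C_x^{m_x} D_x^{n_x} ≥ 0` (the spin-`½` case of
Glimm–Jaffe 1987, eq. (4.3.6): "`0 ≤ ∫ αᵏ βˡ γᵐ δⁿ dμ(ξ) ⋯ dμ(χ')`"). If at some site the four
exponents do not all have the same parity, the sum vanishes by one of the sign symmetries
`repNeg`, `repSwap₁`, `repSwap₂`; otherwise every factor is either a product of even powers or
`A_xB_xC_xD_x` times one, hence nonnegative. [cite: GlimmJaffe1987, proof of Thm. 4.3.1, eq. (4.3.6)] -/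
theorem sum_repMonomial_nonneg (k l m n : Λ → ℕ) : 0 ≤ ∑ c : Cfg4 Λ, repMonomial k l m n c := by
  by_cases h1 : ∃ x, Odd (k x + l x + m x + n x)
  · obtain ⟨x, hodd⟩ := h1
    rw [sum_cfg4_eq_zero_of_odd (repNeg_involutive x) _ fun c => by
      rw [repMonomial_repNeg, hodd.neg_one_pow, neg_one_mul]]
  have h1' : ∀ x, Even (k x + l x + m x + n x) := fun x => Nat.not_odd_iff_even.1 fun h => h1 ⟨x, h⟩
  by_cases h2 : ∃ x, Odd (m x + n x)
  · obtain ⟨x, hodd⟩ := h2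
    rw [sum_cfg4_eq_zero_of_odd (repSwap₁_involutive x) _ fun c => by
      rw [repMonomial_repSwap₁, hodd.neg_one_pow, neg_one_mul]]
  have h2' : ∀ x, Even (m x + n x) := fun x => Nat.not_odd_iff_even.1 fun h => h2 ⟨x, h⟩
  by_cases h3 : ∃ x, Odd (l x + n x)
  · obtain ⟨x, hodd⟩ := h3
    rw [sum_cfg4_eq_zero_of_odd (repSwap₂_involutive x) _ fun c => by
      rw [repMonomial_repSwap₂, hodd.neg_one_pow, neg_one_mul]]
  have h3' : ∀ x, Even (l x + n x) := fun x => Nat.not_odd_iff_even.1 fun h => h3 ⟨x, h⟩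
  refine Finset.sum_nonneg fun c _ => Finset.prod_nonneg fun x _ => ?_
  -- at `x` all four exponents have the parity of `n x`
  rcases Nat.even_or_odd (n x) with hn | hn
  · have hl : Even (l x) := by
      have h := h3' x; rcases Nat.even_or_odd (l x) with h' | h' <;> [exact h'; exact absurd h (Nat.not_even_iff_odd.2 (h'.add_even hn))]
    have hm : Even (m x) := by
      have h := h2' x; rcases Nat.even_or_odd (m x) with h' | h' <;> [exact h'; exact absurd h (Nat.not_even_iff_odd.2 (h'.add_even hn))]
    have hk : Even (k x) := by
      have h := h1' x
      rcases Nat.even_or_odd (k x) with h' | h'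
      · exact h'
      · exact absurd h (Nat.not_even_iff_odd.2 (((h'.add_even hl).add_even hm).add_even hn))
    exact mul_nonneg (mul_nonneg (mul_nonneg (hk.pow_nonneg _) (hl.pow_nonneg _)) (hm.pow_nonneg _))
      (hn.pow_nonneg _)
  · have hl : Odd (l x) := by
      have h := h3' x; rcases Nat.even_or_odd (l x) with h' | h' <;> [exact absurd h (Nat.not_even_iff_odd.2 (h'.add_odd hn)); exact h']
    have hm : Odd (m x) := by
      have h := h2' x; rcases Nat.even_or_odd (m x) with h' | h' <;> [exact absurd h (Nat.not_even_iff_odd.2 (h'.add_odd hn)); exact h']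
    have hk : Odd (k x) := by
      have h := h1' x
      rcases Nat.even_or_odd (k x) with h' | h'
      · exact absurd h (Nat.not_even_iff_odd.2 (((h'.add_odd hl).add_odd hm).add_odd hn))
      · exact h'
    obtain ⟨k', hk'⟩ := hk; obtain ⟨l', hl'⟩ := hl; obtain ⟨m', hm'⟩ := hm; obtain ⟨n', hn'⟩ := hn
    rw [hk', hl', hm', hn']
    have h := repA_mul_repB_mul_repC_mul_repD_nonneg x c
    calc (0 : ℝ) ≤ (repA x c * repB x c * repC x c * repD x c) *
          ((repA x c ^ 2) ^ k' * (repB x c ^ 2) ^ l' * (repC x c ^ 2) ^ m' * (repD x c ^ 2) ^ n') :=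
          mul_nonneg h (by positivity)
      _ = repA x c ^ (2 * k' + 1) * repB x c ^ (2 * l' + 1) * repC x c ^ (2 * m' + 1) *
          repD x c ^ (2 * n' + 1) := by ring

/-- `∑_c M(c) ≥ 0` for every member of the monomial class. [cite: GlimmJaffe1987, proof of Thm. 4.3.1, eq. (4.3.6)] -/
theorem sum_repClass_nonneg : ∀ M ∈ (repClass : Set (Cfg4 Λ → ℝ)), 0 ≤ ∑ c, M c := by
  rintro _ ⟨k, l, m, n, rfl⟩
  exact sum_repMonomial_nonneg k l m n

end Replica

/-! ### Lebowitz' inequality for the spin system `ν_{Λ;K}` with pair and single-site couplings -/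

section Lebowitz

variable {Λ : Type*} [Fintype Λ] [DecidableEq Λ] {ι : Type*}
variable (s : Finset ι) (K : ι → ℝ) (C : ι → Finset Λ)

/-- `ω_C(ξ) + ω_C(χ) + ω_C(ξ') + ω_C(χ')`, the interaction term of the fourfold replicated
Hamiltonian (Glimm–Jaffe 1987, eq. (4.3.5): "`H(ξ) + ⋯ + H(χ')`"). [cite: GlimmJaffe1987, proof of Thm. 4.3.1, eq. (4.3.5)] -/
def quadSum (A : Finset Λ) (c : Cfg4 Λ) : ℝ :=
  spinProduct A c.1 + spinProduct A c.2.1 + spinProduct A c.2.2.1 + spinProduct A c.2.2.2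

/-- The Boltzmann weight `w(ξ)w(χ)w(ξ')w(χ')` of the fourfold replicated system (Glimm–Jaffe 1987,
eq. (4.3.4)). [cite: GlimmJaffe1987, proof of Thm. 4.3.1, eq. (4.3.4)] -/
def gksWeight4 (c : Cfg4 Λ) : ℝ :=
  gksWeight s K C c.1 * gksWeight s K C c.2.1 * gksWeight s K C c.2.2.1 * gksWeight s K C c.2.2.2

omit [Fintype Λ] [DecidableEq Λ] in
/-- `w(ξ)w(χ)w(ξ')w(χ') = exp(∑ᵢ Kᵢ (ω_{Cᵢ}(ξ) + ω_{Cᵢ}(χ) + ω_{Cᵢ}(ξ') + ω_{Cᵢ}(χ')))`. [cite: GlimmJaffe1987, proof of Thm. 4.3.1, eq. (4.3.4)] -/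
theorem gksWeight4_eq_exp (c : Cfg4 Λ) :
    gksWeight4 s K C c = Real.exp (∑ i ∈ s, K i * quadSum (C i) c) := by
  simp only [gksWeight4, gksWeight, gksHamiltonian, ← Real.exp_add, ← Finset.sum_add_distrib,
    quadSum]
  congr 1
  exact Finset.sum_congr rfl fun i _ => by ring

omit [Fintype Λ] [DecidableEq Λ] in
/-- A single-site term in the rotated variables: `ξ_x + χ_x + ξ'_x + χ'_x = A_x` (Glimm–Jaffe 1987,
eq. (4.3.5): the field couples to `2∑ hᵢ αᵢ`). [cite: GlimmJaffe1987, proof of Thm. 4.3.1, eq. (4.3.5)] -/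
theorem quadSum_singleton (x : Λ) (c : Cfg4 Λ) : quadSum {x} c = repA x c := by
  simp [quadSum, spinProduct, repA]

omit [Fintype Λ] [DecidableEq Λ] in
/-- **The rotation is orthogonal** (Glimm–Jaffe 1987, eq. (4.3.5)): for a pair `{x, y}`,
`∑_{replicas} σ_xσ_y = ¼ (A_xA_y + B_xB_y + C_xC_y + D_xD_y)`. [cite: GlimmJaffe1987, proof of Thm. 4.3.1, eq. (4.3.5)] -/
theorem quadSum_pair [DecidableEq Λ] {x y : Λ} (hxy : x ≠ y) (c : Cfg4 Λ) :
    quadSum {x, y} c =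
      4⁻¹ * (repA x c * repA y c) + 4⁻¹ * (repB x c * repB y c) +
        4⁻¹ * (repC x c * repC y c) + 4⁻¹ * (repD x c * repD y c) := by
  simp only [quadSum, spinProduct, Finset.prod_pair hxy, repA, repB, repC, repD]
  ring

/-- One interaction term of the replicated weight preserves the positivity of the monomial class:
for `K ≥ 0` and `|C| ≤ 2`, if `∑ M W ≥ 0` on the class then `∑ M e^{K·quadSum C} W ≥ 0` on the
class (Glimm–Jaffe 1987, proof of Thm. 4.3.1: the replicated pair/field Hamiltonian is
ferromagnetic in `α, β, γ, δ`). [cite: GlimmJaffe1987, proof of Thm. 4.3.1, eq. (4.3.5)] -/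
theorem repClass_exp_quadSum_step {Kc : ℝ} (hK : 0 ≤ Kc) {A : Finset Λ} (hA : A.card ≤ 2)
    {W : Cfg4 Λ → ℝ} (hW : ∀ M ∈ (repClass : Set (Cfg4 Λ → ℝ)), 0 ≤ ∑ c, M c * W c) :
    ∀ M ∈ (repClass : Set (Cfg4 Λ → ℝ)), 0 ≤ ∑ c, M c * (Real.exp (Kc * quadSum A c) * W c) := by
  have hcases : A.card = 0 ∨ A.card = 1 ∨ A.card = 2 := by omega
  rcases hcases with h0 | h1 | h2
  · -- constant term
    rw [Finset.card_eq_zero] at h0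
    subst h0
    intro M hM
    have h : ∑ c, M c * (Real.exp (Kc * quadSum ∅ c) * W c) = Real.exp (Kc * 4) * ∑ c, M c * W c := by
      rw [Finset.mul_sum]
      refine Finset.sum_congr rfl fun c _ => ?_
      simp only [quadSum, spinProduct_empty]
      ring_nf
    rw [h]
    exact mul_nonneg (Real.exp_pos _).le (hW M hM)
  · obtain ⟨x, rfl⟩ := Finset.card_eq_one.1 h1
    simp_rw [quadSum_singleton]
    exact classExp_step repClass_mul_mem hW hK (repA_mem_repClass x)
  · obtain ⟨x, y, hxy, rfl⟩ := Finset.card_eq_two.1 h2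
    simp_rw [quadSum_pair hxy]
    intro M hM
    have h4 : (0 : ℝ) ≤ Kc * 4⁻¹ := by positivity
    have e1 := classExp_step repClass_mul_mem hW h4 (mul_mem_repClass (repD_mem_repClass x)
      (repD_mem_repClass y))
    have e2 := classExp_step repClass_mul_mem e1 h4 (mul_mem_repClass (repC_mem_repClass x)
      (repC_mem_repClass y))
    have e3 := classExp_step repClass_mul_mem e2 h4 (mul_mem_repClass (repB_mem_repClass x)
      (repB_mem_repClass y))
    have e4 := classExp_step repClass_mul_mem e3 h4 (mul_mem_repClass (repA_mem_repClass x)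
      (repA_mem_repClass y)) M hM
    have hexp : ∀ c : Cfg4 Λ, Real.exp (Kc * (4⁻¹ * (repA x c * repA y c) + 4⁻¹ * (repB x c * repB y c) +
        4⁻¹ * (repC x c * repC y c) + 4⁻¹ * (repD x c * repD y c))) * W c =
        Real.exp (Kc * 4⁻¹ * (repA x c * repA y c)) * (Real.exp (Kc * 4⁻¹ * (repB x c * repB y c)) *
          (Real.exp (Kc * 4⁻¹ * (repC x c * repC y c)) *
            (Real.exp (Kc * 4⁻¹ * (repD x c * repD y c)) * W c))) := by
      intro c
      rw [show Kc * (4⁻¹ * (repA x c * repA y c) + 4⁻¹ * (repB x c * repB y c) +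
          4⁻¹ * (repC x c * repC y c) + 4⁻¹ * (repD x c * repD y c)) =
          Kc * 4⁻¹ * (repA x c * repA y c) + (Kc * 4⁻¹ * (repB x c * repB y c) +
            (Kc * 4⁻¹ * (repC x c * repC y c) + Kc * 4⁻¹ * (repD x c * repD y c))) by ring,
        Real.exp_add, Real.exp_add, Real.exp_add]
      ring
    simp_rw [hexp]
    exact e4

/-- **The replicated Gibbs weight is positive on the monomial class** (Glimm–Jaffe 1987,
Thm. 4.3.1, eq. (4.3.3): `0 ≤ ⟨α^A β^B γ^C δ^D⟩`, here for spin `½` with nonnegative pair couplings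
and fields — Lebowitz 1974): for `Kᵢ ≥ 0` on supports of at most two sites,
`∑_c M(c) w(ξ)w(χ)w(ξ')w(χ') ≥ 0` for every monomial `M` in `A, B, C, D`. [cite: GlimmJaffe1987, Thm. 4.3.1, eq. (4.3.3)] -/
theorem sum_repClass_mul_gksWeight4_nonneg (hK : ∀ i ∈ s, 0 ≤ K i) (hC : ∀ i ∈ s, (C i).card ≤ 2) :
    ∀ M ∈ (repClass : Set (Cfg4 Λ → ℝ)), 0 ≤ ∑ c, M c * gksWeight4 s K C c := by
  classical
  simp_rw [gksWeight4_eq_exp]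
  suffices h : ∀ M ∈ (repClass : Set (Cfg4 Λ → ℝ)),
      0 ≤ ∑ c, M c * (Real.exp (∑ i ∈ s, K i * quadSum (C i) c) * (fun _ => (1 : ℝ)) c) by
    simpa using h
  induction s using Finset.induction_on with
  | empty =>
    intro M hM
    simpa using sum_repClass_nonneg M hM
  | insert j s hj ih =>
    have ih' := ih (fun i hi => hK i (Finset.mem_insert_of_mem hi))
      (fun i hi => hC i (Finset.mem_insert_of_mem hi))
    have h := repClass_exp_quadSum_step (hK j (Finset.mem_insert_self j s))
      (hC j (Finset.mem_insert_self j s)) ih'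
    intro M hM
    have hexp : ∀ c : Cfg4 Λ, Real.exp (∑ i ∈ insert j s, K i * quadSum (C i) c) * (fun _ => (1 : ℝ)) c =
        Real.exp (K j * quadSum (C j) c) *
          (Real.exp (∑ i ∈ s, K i * quadSum (C i) c) * (fun _ => (1 : ℝ)) c) := by
      intro c
      rw [Finset.sum_insert hj, Real.exp_add, mul_assoc]
    simp_rw [hexp]
    exact h M hM

/-! #### The duplicated variables `T = σ + σ'`, `Q = σ - σ'` and the pair form of Lebowitz' inequality -/

/-- `T_u(ξ, χ) = ξ_u + χ_u` (`= √2 t_u` of Glimm–Jaffe 1987, eq. (4.1.7)). [cite: GlimmJaffe1987, §4.1, eq. (4.1.7)] -/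
def tVar2 (u : Λ) (ξ χ : SpinConfig Λ) : ℝ := spinAt u ξ + spinAt u χ

/-- `Q_u(ξ, χ) = ξ_u - χ_u` (`= √2 q_u` of Glimm–Jaffe 1987, eq. (4.1.7)). [cite: GlimmJaffe1987, §4.1, eq. (4.1.7)] -/
def qVar2 (u : Λ) (ξ χ : SpinConfig Λ) : ℝ := spinAt u ξ - spinAt u χ

/-- The duplicated (tensor-square) unnormalised expectation
`∑_{ξ,χ} F(ξ,χ) w(ξ) w(χ)` (Glimm–Jaffe 1987, eq. (4.1.8), times `Z²`). [cite: GlimmJaffe1987, §4.1, eq. (4.1.8)] -/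
def gksSum2 (F : SpinConfig Λ → SpinConfig Λ → ℝ) : ℝ :=
  ∑ ξ, ∑ χ, F ξ χ * (gksWeight s K C ξ * gksWeight s K C χ)

omit [Fintype Λ] [DecidableEq Λ] in
/-- `T_u = (A_u + B_u)/2` on the first pair of replicas. [folklore] -/
theorem tVar2_eq (u : Λ) (c : Cfg4 Λ) : tVar2 u c.1 c.2.1 = (repA u c + repB u c) / 2 := by
  simp only [tVar2, repA, repB]; ring

omit [Fintype Λ] [DecidableEq Λ] in
/-- `Q_u = (C_u - D_u)/2` on the first pair of replicas. [folklore] -/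
theorem qVar2_eq (u : Λ) (c : Cfg4 Λ) : qVar2 u c.1 c.2.1 = (repC u c - repD u c) / 2 := by
  simp only [qVar2, repC, repD]; ring

omit [Fintype Λ] [DecidableEq Λ] in
/-- `Q'_u = (C_u + D_u)/2` on the second pair of replicas. [folklore] -/
theorem qVar2_eq' (u : Λ) (c : Cfg4 Λ) : qVar2 u c.2.2.1 c.2.2.2 = (repC u c + repD u c) / 2 := by
  simp only [qVar2, repC, repD]; ring

/-- Splitting a sum over the four replicas of a product of a function of `(ξ, χ)` and a function of
`(ξ', χ')`. [folklore] -/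
theorem sum_cfg4_mul_mul_gksWeight4 (F G : SpinConfig Λ → SpinConfig Λ → ℝ) :
    ∑ c : Cfg4 Λ, F c.1 c.2.1 * G c.2.2.1 c.2.2.2 * gksWeight4 s K C c =
      gksSum2 s K C F * gksSum2 s K C G := by
  rw [gksSum2, gksSum2, Finset.sum_mul]
  simp only [Fintype.sum_prod_type, gksWeight4]
  refine Finset.sum_congr rfl fun ξ _ => ?_
  rw [Finset.sum_mul]
  refine Finset.sum_congr rfl fun χ _ => ?_
  rw [Finset.mul_sum]
  refine Finset.sum_congr rfl fun ξ' _ => ?_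
  rw [Finset.mul_sum]
  exact Finset.sum_congr rfl fun χ' _ => by ring

/-- **Lebowitz' inequality** `⟨t_zt_y q_aq_x⟩ ≤ ⟨t_zt_y⟩⟨q_aq_x⟩` (Glimm–Jaffe 1987, Cor. 4.3.2, third
inequality, for `|A| = |B| = 2`; Lebowitz 1974), in unnormalised form for the spin system
`ν_{Λ;K}` with `Kᵢ ≥ 0` on supports of at most two sites:
`Z² ∑∑ T_zT_yQ_aQ_x ww ≤ (∑∑ T_zT_y ww)(∑∑ Q_aQ_x ww)`. Proof: the difference is
`∑_c T_zT_y(ξ,χ)[Q_aQ_x(ξ',χ') - Q_aQ_x(ξ,χ)] w⁴` and `T_zT_y = ¼(A+B)_z(A+B)_y`,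
`Q'_aQ'_x - Q_aQ_x = ½(C_aD_x + D_aC_x)` are nonnegative combinations of monomials. [cite: GlimmJaffe1987, Cor. 4.3.2] [cite: Lebowitz1974, Theorem, eq. (2.5b)] -/
theorem lebowitz_pair (hK : ∀ i ∈ s, 0 ≤ K i) (hC : ∀ i ∈ s, (C i).card ≤ 2) (z y a x : Λ) :
    gksSum2 s K C (fun ξ χ => tVar2 z ξ χ * tVar2 y ξ χ * (qVar2 a ξ χ * qVar2 x ξ χ)) *
        gksSum2 s K C (fun _ _ => 1) ≤
      gksSum2 s K C (fun ξ χ => tVar2 z ξ χ * tVar2 y ξ χ) *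
        gksSum2 s K C (fun ξ χ => qVar2 a ξ χ * qVar2 x ξ χ) := by
  rw [← sub_nonneg, ← sum_cfg4_mul_mul_gksWeight4, ← sum_cfg4_mul_mul_gksWeight4,
    ← Finset.sum_sub_distrib]
  have hpos := sum_repClass_mul_gksWeight4_nonneg s K C hK hC
  -- the eight monomials
  have key : ∀ c : Cfg4 Λ,
      tVar2 z c.1 c.2.1 * tVar2 y c.1 c.2.1 * (qVar2 a c.2.2.1 c.2.2.2 * qVar2 x c.2.2.1 c.2.2.2) *
          gksWeight4 s K C c -
        tVar2 z c.1 c.2.1 * tVar2 y c.1 c.2.1 * (qVar2 a c.1 c.2.1 * qVar2 x c.1 c.2.1) * 1 *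
          gksWeight4 s K C c =
      8⁻¹ * ((repA z c * repA y c * (repC a c * repD x c)) * gksWeight4 s K C c) +
      8⁻¹ * ((repA z c * repA y c * (repD a c * repC x c)) * gksWeight4 s K C c) +
      8⁻¹ * ((repA z c * repB y c * (repC a c * repD x c)) * gksWeight4 s K C c) +
      8⁻¹ * ((repA z c * repB y c * (repD a c * repC x c)) * gksWeight4 s K C c) +
      8⁻¹ * ((repB z c * repA y c * (repC a c * repD x c)) * gksWeight4 s K C c) +
      8⁻¹ * ((repB z c * repA y c * (repD a c * repC x c)) * gksWeight4 s K C c) +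
      8⁻¹ * ((repB z c * repB y c * (repC a c * repD x c)) * gksWeight4 s K C c) +
      8⁻¹ * ((repB z c * repB y c * (repD a c * repC x c)) * gksWeight4 s K C c) := by
    intro c
    rw [tVar2_eq, tVar2_eq, qVar2_eq, qVar2_eq, qVar2_eq', qVar2_eq']
    ring
  simp_rw [key, Finset.sum_add_distrib, ← Finset.mul_sum]
  have hm : ∀ (P Q R S : Cfg4 Λ → ℝ), P ∈ repClass → Q ∈ repClass → R ∈ repClass → S ∈ repClass →
      0 ≤ 8⁻¹ * ∑ c, P c * Q c * (R c * S c) * gksWeight4 s K C c := by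
    intro P Q R S hP hQ hR hS
    refine mul_nonneg (by norm_num) (hpos (fun c => P c * Q c * (R c * S c)) ?_)
    exact mul_mem_repClass (mul_mem_repClass hP hQ) (mul_mem_repClass hR hS)
  have hA := repA_mem_repClass (Λ := Λ)
  have hB := repB_mem_repClass (Λ := Λ)
  have hC' := repC_mem_repClass (Λ := Λ)
  have hD := repD_mem_repClass (Λ := Λ)
  refine add_nonneg (add_nonneg (add_nonneg (add_nonneg (add_nonneg (add_nonneg (add_nonneg
    (hm _ _ _ _ (hA z) (hA y) (hC' a) (hD x)) (hm _ _ _ _ (hA z) (hA y) (hD a) (hC' x)))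
    (hm _ _ _ _ (hA z) (hB y) (hC' a) (hD x))) (hm _ _ _ _ (hA z) (hB y) (hD a) (hC' x)))
    (hm _ _ _ _ (hB z) (hA y) (hC' a) (hD x))) (hm _ _ _ _ (hB z) (hA y) (hD a) (hC' x)))
    (hm _ _ _ _ (hB z) (hB y) (hC' a) (hD x))) (hm _ _ _ _ (hB z) (hB y) (hD a) (hC' x))

/-! #### The covariance of two pair observables `spinPair u v = σ_uσ_v` -/

omit [Fintype Λ] in
/-- `σ_u σ_v = σ_{{u} ∆ {v}}` for the tree's pair observable `spinPair u v` (`Correlations`; on the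
diagonal both sides are `1`). [folklore] -/
theorem spinPair_eq_spinProduct_singleton_symmDiff (u v : Λ) : spinPair u v = spinProduct ({u} ∆ {v}) := by
  funext σ
  rw [spinPair, ← spinProduct_mul_eq_spinProduct_symmDiff]
  simp [spinProduct]

omit [Fintype Λ] [DecidableEq Λ] in
/-- `σ_u = σ_{{u}}` as observables. [folklore] -/
theorem spinAt_eq_spinProduct_singleton (u : Λ) : (fun σ => spinAt u σ) = spinProduct {u} := by
  funext σ; simp [spinProduct]

omit [Fintype Λ] [DecidableEq Λ] in
/-- `σ_u σ_v = σ_v σ_u`. [folklore] -/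
theorem spinPair_comm (u v : Λ) : spinPair u v = spinPair v u := by
  funext σ; simp [spinPair, mul_comm]

omit [Fintype Λ] in
/-- `σ_{{x,y}} = σ_x σ_y` for `x ≠ y`. [folklore] -/
theorem spinProduct_pair_eq_spinPair {x y : Λ} (hxy : x ≠ y) : spinProduct {x, y} = spinPair x y := by
  funext σ; simp [spinProduct, Finset.prod_pair hxy, spinPair]

/-- GKS I for one spin: `Z⟨σ_u⟩ ≥ 0`. [cite: FriedliVelenik2017, Thm. 3.49, eq. (3.54), p. 141] -/
theorem gksSum_spinAt_nonneg [DecidableEq ι] (hK : ∀ i ∈ s, 0 ≤ K i) (u : Λ) :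
    0 ≤ gksSum s K C (fun σ => spinAt u σ) := by
  rw [spinAt_eq_spinProduct_singleton]; exact gksSum_spinProduct_nonneg s K C hK {u}

/-- GKS I for a pair: `Z⟨σ_uσ_v⟩ ≥ 0`. [cite: FriedliVelenik2017, Thm. 3.49, eq. (3.54), p. 141] -/
theorem gksSum_spinPair_nonneg [DecidableEq ι] (hK : ∀ i ∈ s, 0 ≤ K i) (u v : Λ) :
    0 ≤ gksSum s K C (spinPair u v) := by
  rw [spinPair_eq_spinProduct_singleton_symmDiff]; exact gksSum_spinProduct_nonneg s K C hK _

/-- GKS II for two spins: `(Z⟨σ_u⟩)(Z⟨σ_v⟩) ≤ (Z⟨σ_uσ_v⟩) Z`. [cite: FriedliVelenik2017, Thm. 3.49, eq. (3.55), pp. 141–142] -/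
theorem gksSum_spinAt_mul_le [DecidableEq ι] (hK : ∀ i ∈ s, 0 ≤ K i) (u v : Λ) :
    gksSum s K C (fun σ => spinAt u σ) * gksSum s K C (fun σ => spinAt v σ) ≤
      gksSum s K C (spinPair u v) * gksSum s K C (fun _ => 1) := by
  rw [spinAt_eq_spinProduct_singleton, spinAt_eq_spinProduct_singleton, spinPair_eq_spinProduct_singleton_symmDiff]
  exact gksSum_mul_gksSum_le s K C hK {u} {v}

/-- `∑∑ T_uT_v ww = 2 (Z⟨σ_uσ_v⟩) Z + 2 (Z⟨σ_u⟩)(Z⟨σ_v⟩)`. [folklore] -/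
theorem gksSum2_tVar2_mul (u v : Λ) :
    gksSum2 s K C (fun ξ χ => tVar2 u ξ χ * tVar2 v ξ χ) =
      2 * (gksSum s K C (spinPair u v) * gksSum s K C (fun _ => 1)) +
        2 * (gksSum s K C (fun σ => spinAt u σ) * gksSum s K C (fun σ => spinAt v σ)) := by
  have key : ∀ ξ χ : SpinConfig Λ, tVar2 u ξ χ * tVar2 v ξ χ * (gksWeight s K C ξ * gksWeight s K C χ) =
      (spinAt u ξ * spinAt v ξ * gksWeight s K C ξ) * (1 * gksWeight s K C χ) +
      (spinAt u ξ * gksWeight s K C ξ) * (spinAt v χ * gksWeight s K C χ) +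
      (spinAt v ξ * gksWeight s K C ξ) * (spinAt u χ * gksWeight s K C χ) +
      (1 * gksWeight s K C ξ) * (spinAt u χ * spinAt v χ * gksWeight s K C χ) := by
    intro ξ χ; simp only [tVar2]; ring
  simp only [gksSum2, key, Finset.sum_add_distrib, ← Finset.sum_mul_sum]
  simp only [gksSum, spinPair]
  ring

/-- `∑∑ Q_uQ_v ww = 2 (Z⟨σ_uσ_v⟩) Z - 2 (Z⟨σ_u⟩)(Z⟨σ_v⟩)`. [folklore] -/
theorem gksSum2_qVar2_mul (u v : Λ) :
    gksSum2 s K C (fun ξ χ => qVar2 u ξ χ * qVar2 v ξ χ) =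
      2 * (gksSum s K C (spinPair u v) * gksSum s K C (fun _ => 1)) -
        2 * (gksSum s K C (fun σ => spinAt u σ) * gksSum s K C (fun σ => spinAt v σ)) := by
  have key : ∀ ξ χ : SpinConfig Λ, qVar2 u ξ χ * qVar2 v ξ χ * (gksWeight s K C ξ * gksWeight s K C χ) =
      (spinAt u ξ * spinAt v ξ * gksWeight s K C ξ) * (1 * gksWeight s K C χ) +
      (1 * gksWeight s K C ξ) * (spinAt u χ * spinAt v χ * gksWeight s K C χ) -
      ((spinAt u ξ * gksWeight s K C ξ) * (spinAt v χ * gksWeight s K C χ) +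
      (spinAt v ξ * gksWeight s K C ξ) * (spinAt u χ * gksWeight s K C χ)) := by
    intro ξ χ; simp only [qVar2]; ring
  simp only [gksSum2, key, Finset.sum_add_distrib, Finset.sum_sub_distrib, ← Finset.sum_mul_sum]
  simp only [gksSum, spinPair]
  ring

/-- `∑∑ 1 ww = Z²`. [folklore] -/
theorem gksSum2_one : gksSum2 s K C (fun _ _ => 1) = gksSum s K C (fun _ => 1) * gksSum s K C (fun _ => 1) := by
  simp only [gksSum2, gksSum, Finset.sum_mul_sum, one_mul]

omit [DecidableEq Λ] in
/-- Symmetrising a double sum: `∑∑ F(ξ,χ) = ∑∑ ½(F(ξ,χ) + F(χ,ξ))`. [folklore] -/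
theorem sum_sum_symmetrize {α : Type*} [Fintype α] (F : α → α → ℝ) :
    ∑ ξ, ∑ χ, F ξ χ = ∑ ξ, ∑ χ, 2⁻¹ * (F ξ χ + F χ ξ) := by
  have h : ∑ ξ, ∑ χ, F ξ χ = ∑ ξ, ∑ χ, F χ ξ := Finset.sum_comm
  calc ∑ ξ, ∑ χ, F ξ χ = 2⁻¹ * (∑ ξ, ∑ χ, F ξ χ + ∑ ξ, ∑ χ, F χ ξ) := by rw [← h]; ring
    _ = ∑ ξ, ∑ χ, 2⁻¹ * (F ξ χ + F χ ξ) := by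
      rw [← Finset.sum_add_distrib, Finset.mul_sum]
      refine Finset.sum_congr rfl fun ξ _ => ?_
      rw [← Finset.sum_add_distrib, Finset.mul_sum]

/-- **The covariance of two pair observables in the duplicated variables**:
`Z·(Z⟨σ_aσ_z σ_xσ_y⟩) - (Z⟨σ_aσ_z⟩)(Z⟨σ_xσ_y⟩) = ½ ∑∑ (f(ξ)-f(χ))(g(ξ)-g(χ)) ww` with
`f(ξ) - f(χ) = ½(Q_aT_z + T_aQ_z)`, `g(ξ) - g(χ) = ½(Q_xT_y + T_xQ_y)`, i.e.
`= ⅛ ∑∑ (T_zT_yQ_aQ_x + T_zT_xQ_aQ_y + T_aT_yQ_zQ_x + T_aT_xQ_zQ_y) ww` (Glimm–Jaffe 1987, proof of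
(4.1.11): `⟨ξ^Aξ^B⟩ - ⟨ξ^A⟩⟨ξ^B⟩ = ⟨ξ^A(ξ^B - χ^B)⟩`, written in `t, q`). [cite: GlimmJaffe1987, proof of Thm. 4.1.3, eq. (4.1.11)] -/
theorem cov_spinPair_eq_gksSum2 (a z x y : Λ) :
    gksSum s K C (fun _ => 1) * gksSum s K C (fun σ => spinPair a z σ * spinPair x y σ) -
        gksSum s K C (spinPair a z) * gksSum s K C (spinPair x y) =
      8⁻¹ * (gksSum2 s K C (fun ξ χ => tVar2 z ξ χ * tVar2 y ξ χ * (qVar2 a ξ χ * qVar2 x ξ χ)) +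
        gksSum2 s K C (fun ξ χ => tVar2 z ξ χ * tVar2 x ξ χ * (qVar2 a ξ χ * qVar2 y ξ χ)) +
        gksSum2 s K C (fun ξ χ => tVar2 a ξ χ * tVar2 y ξ χ * (qVar2 z ξ χ * qVar2 x ξ χ)) +
        gksSum2 s K C (fun ξ χ => tVar2 a ξ χ * tVar2 x ξ χ * (qVar2 z ξ χ * qVar2 y ξ χ))) := by
  -- both sides as symmetric double sums
  set w := gksWeight s K C with hw
  have hL : gksSum s K C (fun _ => 1) * gksSum s K C (fun σ => spinPair a z σ * spinPair x y σ) -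
      gksSum s K C (spinPair a z) * gksSum s K C (spinPair x y) =
      ∑ ξ, ∑ χ, (spinPair a z χ * spinPair x y χ - spinPair a z ξ * spinPair x y χ) * (w ξ * w χ) := by
    simp only [gksSum, Finset.sum_mul_sum, ← Finset.sum_sub_distrib, ← hw]
    exact Finset.sum_congr rfl fun ξ _ => Finset.sum_congr rfl fun χ _ => by ring
  have hL2 : ∑ ξ, ∑ χ, (spinPair a z χ * spinPair x y χ - spinPair a z ξ * spinPair x y χ) * (w ξ * w χ) =
      ∑ ξ, ∑ χ, 2⁻¹ * ((spinPair a z ξ - spinPair a z χ) * (spinPair x y ξ - spinPair x y χ)) *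
        (w ξ * w χ) := by
    rw [sum_sum_symmetrize]
    exact Finset.sum_congr rfl fun ξ _ => Finset.sum_congr rfl fun χ _ => by ring
  rw [hL, hL2]
  simp only [gksSum2, ← hw, Finset.mul_sum, ← Finset.sum_add_distrib]
  refine Finset.sum_congr rfl fun ξ _ => Finset.sum_congr rfl fun χ _ => ?_
  simp only [spinPair, tVar2, qVar2]
  ring

/-- One Lebowitz term: `∑∑ T_uT_vQ_pQ_r ww ≤ 8 (Z⟨σ_pσ_r⟩)(Z⟨σ_uσ_v⟩)`, from `lebowitz_pair` and the
Griffiths bounds `0 ≤ ∑∑ T_uT_v ww ≤ 4 Z (Z⟨σ_uσ_v⟩)`, `0 ≤ ∑∑ Q_pQ_r ww ≤ 2 Z (Z⟨σ_pσ_r⟩)`. [cite: GlimmJaffe1987, Cor. 4.3.2] -/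
theorem gksSum2_ttqq_le [DecidableEq ι] (hK : ∀ i ∈ s, 0 ≤ K i) (hC : ∀ i ∈ s, (C i).card ≤ 2)
    (u v p r : Λ) :
    gksSum2 s K C (fun ξ χ => tVar2 u ξ χ * tVar2 v ξ χ * (qVar2 p ξ χ * qVar2 r ξ χ)) ≤
      8 * (gksSum s K C (spinPair p r) * gksSum s K C (spinPair u v)) := by
  have hZ := gksSum_one_pos s K C
  have hleb := lebowitz_pair s K C hK hC u v p r
  rw [gksSum2_one] at hleb
  have hT := gksSum2_tVar2_mul s K C u v
  have hQ := gksSum2_qVar2_mul s K C p r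
  have hT0 : 0 ≤ gksSum2 s K C (fun ξ χ => tVar2 u ξ χ * tVar2 v ξ χ) := by
    rw [hT]
    exact add_nonneg (mul_nonneg (by norm_num) (mul_nonneg (gksSum_spinPair_nonneg s K C hK u v) hZ.le))
      (mul_nonneg (by norm_num) (mul_nonneg (gksSum_spinAt_nonneg s K C hK u)
        (gksSum_spinAt_nonneg s K C hK v)))
  have hT4 : gksSum2 s K C (fun ξ χ => tVar2 u ξ χ * tVar2 v ξ χ) ≤
      4 * (gksSum s K C (spinPair u v) * gksSum s K C (fun _ => 1)) := by
    rw [hT]; linarith [gksSum_spinAt_mul_le s K C hK u v]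
  have hQ0 : 0 ≤ gksSum2 s K C (fun ξ χ => qVar2 p ξ χ * qVar2 r ξ χ) := by
    rw [hQ]; linarith [gksSum_spinAt_mul_le s K C hK p r]
  have hQ2 : gksSum2 s K C (fun ξ χ => qVar2 p ξ χ * qVar2 r ξ χ) ≤
      2 * (gksSum s K C (spinPair p r) * gksSum s K C (fun _ => 1)) := by
    rw [hQ]
    linarith [mul_nonneg (gksSum_spinAt_nonneg s K C hK p) (gksSum_spinAt_nonneg s K C hK r)]
  have hprod : gksSum2 s K C (fun ξ χ => tVar2 u ξ χ * tVar2 v ξ χ) *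
      gksSum2 s K C (fun ξ χ => qVar2 p ξ χ * qVar2 r ξ χ) ≤
      (4 * (gksSum s K C (spinPair u v) * gksSum s K C (fun _ => 1))) *
        (2 * (gksSum s K C (spinPair p r) * gksSum s K C (fun _ => 1))) :=
    mul_le_mul hT4 hQ2 hQ0 (by linarith)
  have h := hleb.trans hprod
  -- divide by Z²
  have hZ2 : 0 < gksSum s K C (fun _ => 1) * gksSum s K C (fun _ => 1) := mul_pos hZ hZ
  have h' : gksSum2 s K C (fun ξ χ => tVar2 u ξ χ * tVar2 v ξ χ * (qVar2 p ξ χ * qVar2 r ξ χ)) *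
      (gksSum s K C (fun _ => 1) * gksSum s K C (fun _ => 1)) ≤
      8 * (gksSum s K C (spinPair p r) * gksSum s K C (spinPair u v)) *
        (gksSum s K C (fun _ => 1) * gksSum s K C (fun _ => 1)) := by
    calc _ ≤ _ := h
      _ = _ := by ring
  exact le_of_mul_le_mul_right h' hZ2

/-- **Lebowitz' bound on the covariance of two pair observables** (the consequence of
Glimm–Jaffe 1987, Cor. 4.3.2 / Lebowitz 1974 used to bound `∂⟨σ_aσ_z⟩/∂J_{xy}` by two-point
functions, cf. Glimm–Jaffe 1987, Cor. 4.3.3 and §17): for `Kᵢ ≥ 0` on supports of at most two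
sites,
`⟨σ_aσ_z σ_xσ_y⟩ - ⟨σ_aσ_z⟩⟨σ_xσ_y⟩ ≤ 2 (⟨σ_aσ_x⟩⟨σ_yσ_z⟩ + ⟨σ_aσ_y⟩⟨σ_xσ_z⟩)`. [cite: GlimmJaffe1987, Cor. 4.3.2 and Cor. 4.3.3] -/
theorem gksExpect_cov_spinPair_le [DecidableEq ι] (hK : ∀ i ∈ s, 0 ≤ K i)
    (hC : ∀ i ∈ s, (C i).card ≤ 2) (a z x y : Λ) :
    gksExpect s K C (fun σ => spinPair a z σ * spinPair x y σ) -
        gksExpect s K C (spinPair a z) * gksExpect s K C (spinPair x y) ≤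
      2 * (gksExpect s K C (spinPair a x) * gksExpect s K C (spinPair y z) +
        gksExpect s K C (spinPair a y) * gksExpect s K C (spinPair x z)) := by
  have hZ := gksSum_one_pos s K C
  set Z := gksSum s K C (fun _ => 1) with hZdef
  have hcov := cov_spinPair_eq_gksSum2 s K C a z x y
  have h1 := gksSum2_ttqq_le s K C hK hC z y a x
  have h2 := gksSum2_ttqq_le s K C hK hC z x a y
  have h3 := gksSum2_ttqq_le s K C hK hC a y z x
  have h4 := gksSum2_ttqq_le s K C hK hC a x z y
  have hun : Z * gksSum s K C (fun σ => spinPair a z σ * spinPair x y σ) -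
      gksSum s K C (spinPair a z) * gksSum s K C (spinPair x y) ≤
      2 * (gksSum s K C (spinPair a x) * gksSum s K C (spinPair y z) +
        gksSum s K C (spinPair a y) * gksSum s K C (spinPair x z)) := by
    rw [spinPair_comm z y] at h1 h4
    rw [spinPair_comm z x] at h2 h3
    rw [hZdef, hcov]
    linarith
  simp only [gksExpect, ← hZdef]
  rw [div_mul_div_comm, div_mul_div_comm, div_mul_div_comm, div_sub_div _ _ hZ.ne' (mul_pos hZ hZ).ne',
    ← add_div, ← mul_div_assoc, div_le_div_iff₀ (mul_pos hZ (mul_pos hZ hZ)) (mul_pos hZ hZ)]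
  have hZ3 : 0 < Z * (Z * Z) := mul_pos hZ (mul_pos hZ hZ)
  nlinarith [hun, hZ, mul_pos hZ hZ]

end Lebowitz

/-! ### Switching on the couplings across a boundary -/

section Boundary

variable {Λ : Type*} [Fintype Λ] [DecidableEq Λ] {ι : Type*} [DecidableEq ι]
variable (s : Finset ι) (K : ι → ℝ) (C : ι → Finset Λ) (B : Finset ι)

/-- Interpolated couplings: `t Kᵢ` on the terms `i ∈ B` to be switched on, `Kᵢ` elsewhere
(the coupling-constant interpolation of Simon 1980 / Lieb 1980; cf. Glimm–Jaffe 1987, §4.2,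
Prop. 4.2.1: `d⟨ξ^B⟩/dJ_A = ⟨ξ^Bξ^A⟩ - ⟨ξ^A⟩⟨ξ^B⟩`). [cite: GlimmJaffe1987, §4.2, Prop. 4.2.1] -/
def cplAt (t : ℝ) : ι → ℝ := fun i => if i ∈ B then t * K i else K i

/-- The couplings of the switched terms alone. [folklore] -/
def cplOn : ι → ℝ := fun i => if i ∈ B then K i else 0

/-- The couplings with the switched terms removed (`t = 0`). [folklore] -/
def cplOff : ι → ℝ := fun i => if i ∈ B then 0 else K i

omit [Fintype Λ] [DecidableEq Λ] in
/-- `cplAt t = cplOff + t · cplOn`. [folklore] -/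
theorem cplAt_eq (t : ℝ) (i : ι) : cplAt K B t i = cplOff K B i + t * cplOn K B i := by
  unfold cplAt cplOff cplOn; split_ifs <;> ring

omit [Fintype Λ] [DecidableEq Λ] in
/-- `cplAt 1 = K`. [folklore] -/
theorem cplAt_one : cplAt K B 1 = K := by
  funext i; unfold cplAt; split_ifs <;> ring

omit [Fintype Λ] [DecidableEq Λ] in
/-- `cplAt 0 = cplOff`. [folklore] -/
theorem cplAt_zero : cplAt K B 0 = cplOff K B := by
  funext i; unfold cplAt cplOff; split_ifs <;> ring

omit [Fintype Λ] [DecidableEq Λ] in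
/-- `|cplAt t i| ≤ Kᵢ` for `t ∈ [0,1]`, `K ≥ 0`. [folklore] -/
theorem abs_cplAt_le (hK : ∀ i ∈ s, 0 ≤ K i) {t : ℝ} (ht0 : 0 ≤ t) (ht1 : t ≤ 1) :
    ∀ i ∈ s, |cplAt K B t i| ≤ K i := by
  intro i hi
  unfold cplAt
  split_ifs
  · rw [abs_of_nonneg (mul_nonneg ht0 (hK i hi))]
    exact mul_le_of_le_one_left (hK i hi) ht1
  · rw [abs_of_nonneg (hK i hi)]

omit [Fintype Λ] [DecidableEq Λ] in
/-- `cplAt t ≥ 0` for `t ≥ 0`, `K ≥ 0`. [folklore] -/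
theorem cplAt_nonneg (hK : ∀ i ∈ s, 0 ≤ K i) {t : ℝ} (ht0 : 0 ≤ t) : ∀ i ∈ s, 0 ≤ cplAt K B t i := by
  intro i hi
  unfold cplAt
  split_ifs
  · exact mul_nonneg ht0 (hK i hi)
  · exact hK i hi

omit [Fintype Λ] [DecidableEq Λ] in
/-- The interpolated Hamiltonian is affine in `t`. [folklore] -/
theorem gksHamiltonian_cplAt (t : ℝ) (ω : SpinConfig Λ) :
    gksHamiltonian s (cplAt K B t) C ω =
      gksHamiltonian s (cplOff K B) C ω + t * gksHamiltonian s (cplOn K B) C ω := by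
  simp only [gksHamiltonian, cplAt_eq, Finset.mul_sum, ← Finset.sum_add_distrib]
  exact Finset.sum_congr rfl fun i _ => by ring

/-- `d/dt (Z_t ⟨F⟩_t) = Z_t ⟨F · H_B⟩_t` along the interpolation (elementary calculus on finite sums
of exponentials; Glimm–Jaffe 1987, proof of Prop. 4.2.1). [cite: GlimmJaffe1987, §4.2, Prop. 4.2.1] -/
theorem hasDerivAt_gksSum_cplAt (F : SpinConfig Λ → ℝ) (t : ℝ) :
    HasDerivAt (fun t => gksSum s (cplAt K B t) C F)
      (gksSum s (cplAt K B t) C (fun ω => F ω * gksHamiltonian s (cplOn K B) C ω)) t := by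
  have hfun : (fun t => gksSum s (cplAt K B t) C F) = fun t => ∑ ω, F ω *
      Real.exp (gksHamiltonian s (cplOff K B) C ω + t * gksHamiltonian s (cplOn K B) C ω) := by
    funext t; simp only [gksSum, gksWeight, gksHamiltonian_cplAt]
  have hval : gksSum s (cplAt K B t) C (fun ω => F ω * gksHamiltonian s (cplOn K B) C ω) =
      ∑ ω, F ω * (Real.exp (gksHamiltonian s (cplOff K B) C ω + t * gksHamiltonian s (cplOn K B) C ω) *
        gksHamiltonian s (cplOn K B) C ω) := by
    simp only [gksSum, gksWeight, gksHamiltonian_cplAt]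
    exact Finset.sum_congr rfl fun ω _ => by ring
  rw [hfun, hval]
  refine HasDerivAt.fun_sum fun ω _ => ?_
  have h1 : HasDerivAt (fun t : ℝ => gksHamiltonian s (cplOff K B) C ω +
      t * gksHamiltonian s (cplOn K B) C ω) (gksHamiltonian s (cplOn K B) C ω) t := by
    simpa using (hasDerivAt_mul_const (x := t) (gksHamiltonian s (cplOn K B) C ω)).const_add
      (gksHamiltonian s (cplOff K B) C ω)
  exact h1.exp.const_mul (F ω)

/-- The derivative of `⟨F⟩_t` along the interpolation (quotient rule). [cite: GlimmJaffe1987, §4.2, Prop. 4.2.1] -/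
theorem hasDerivAt_gksExpect_cplAt (F : SpinConfig Λ → ℝ) (t : ℝ) :
    HasDerivAt (fun t => gksExpect s (cplAt K B t) C F)
      ((gksSum s (cplAt K B t) C (fun ω => F ω * gksHamiltonian s (cplOn K B) C ω) *
          gksSum s (cplAt K B t) C (fun _ => 1) -
        gksSum s (cplAt K B t) C F *
          gksSum s (cplAt K B t) C (fun ω => (1 : ℝ) * gksHamiltonian s (cplOn K B) C ω)) /
        gksSum s (cplAt K B t) C (fun _ => 1) ^ 2) t :=
  (hasDerivAt_gksSum_cplAt s K C B F t).div (hasDerivAt_gksSum_cplAt s K C B (fun _ => 1) t)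
    (gksSum_one_pos _ _ _).ne'

variable (px py : ι → Λ)

omit [Fintype Λ] in
/-- On `B` the interaction terms are the bonds `σ_{px i} σ_{py i}`: `H_B = ∑_{i∈B} Kᵢ σ_{px i}σ_{py i}`. [folklore] -/
theorem gksHamiltonian_cplOn_eq (hBs : B ⊆ s) (hB : ∀ i ∈ B, C i = {px i, py i})
    (hpxy : ∀ i ∈ B, px i ≠ py i) (ω : SpinConfig Λ) :
    gksHamiltonian s (cplOn K B) C ω = ∑ i ∈ B, K i * spinPair (px i) (py i) ω := by
  simp only [gksHamiltonian, cplOn, ite_mul, zero_mul]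
  rw [Finset.sum_ite_mem, Finset.inter_eq_right.2 hBs]
  refine Finset.sum_congr rfl fun i hi => ?_
  rw [hB i hi, spinProduct_pair_eq_spinPair (hpxy i hi)]

/-- `Z⟨F H_B⟩ = ∑_{i∈B} Kᵢ Z⟨F σ_{px i}σ_{py i}⟩`. [folklore] -/
theorem gksSum_mul_cplOn (hBs : B ⊆ s) (hB : ∀ i ∈ B, C i = {px i, py i})
    (hpxy : ∀ i ∈ B, px i ≠ py i) (K' : ι → ℝ) (F : SpinConfig Λ → ℝ) :
    gksSum s K' C (fun ω => F ω * gksHamiltonian s (cplOn K B) C ω) =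
      ∑ i ∈ B, K i * gksSum s K' C (fun ω => F ω * spinPair (px i) (py i) ω) := by
  simp only [gksSum, gksHamiltonian_cplOn_eq s K C B px py hBs hB hpxy, Finset.mul_sum,
    Finset.sum_mul]
  rw [Finset.sum_comm]
  exact Finset.sum_congr rfl fun i _ => Finset.sum_congr rfl fun ω _ => by ring

/-- The derivative of `⟨F⟩_t` as a sum of covariances: `∑_{i∈B} Kᵢ (⟨Fσ_{xᵢ}σ_{yᵢ}⟩_t -
⟨F⟩_t⟨σ_{xᵢ}σ_{yᵢ}⟩_t)` (Glimm–Jaffe 1987, Prop. 4.2.1). [cite: GlimmJaffe1987, §4.2, Prop. 4.2.1] -/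
theorem hasDerivAt_gksExpect_cplAt_cov (hBs : B ⊆ s) (hB : ∀ i ∈ B, C i = {px i, py i})
    (hpxy : ∀ i ∈ B, px i ≠ py i) (F : SpinConfig Λ → ℝ) (t : ℝ) :
    HasDerivAt (fun t => gksExpect s (cplAt K B t) C F)
      (∑ i ∈ B, K i * (gksExpect s (cplAt K B t) C (fun ω => F ω * spinPair (px i) (py i) ω) -
        gksExpect s (cplAt K B t) C F * gksExpect s (cplAt K B t) C (spinPair (px i) (py i)))) t := by
  have h := hasDerivAt_gksExpect_cplAt s K C B F t
  have hZ := gksSum_one_pos s (cplAt K B t) C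
  set Z := gksSum s (cplAt K B t) C (fun _ => 1) with hZdef
  convert h using 1
  rw [gksSum_mul_cplOn s K C B px py hBs hB hpxy, gksSum_mul_cplOn s K C B px py hBs hB hpxy]
  simp only [gksExpect, ← hZdef, one_mul]
  have hpt : ∀ i ∈ B, K i * (gksSum s (cplAt K B t) C (fun ω => F ω * spinPair (px i) (py i) ω) / Z -
      gksSum s (cplAt K B t) C F / Z * (gksSum s (cplAt K B t) C (spinPair (px i) (py i)) / Z)) =
      (K i * (gksSum s (cplAt K B t) C (fun ω => F ω * spinPair (px i) (py i) ω) * Z) -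
        gksSum s (cplAt K B t) C F * (K i * gksSum s (cplAt K B t) C (spinPair (px i) (py i)))) / Z ^ 2 := by
    intro i _
    field_simp
  rw [Finset.sum_congr rfl hpt, ← Finset.sum_div]
  congr 1
  rw [Finset.sum_mul, Finset.mul_sum, ← Finset.sum_sub_distrib]
  exact Finset.sum_congr rfl fun i _ => by ring

/-! #### The symmetry at `t = 0` -/

omit [Fintype Λ] in
/-- `σ_A(flip) = (-1)^{|A ∩ S'|} σ_A`. [folklore] -/
theorem spinProduct_flipOn (S' A : Finset Λ) (σ : SpinConfig Λ) :
    spinProduct A (flipOn S' σ) = (-1) ^ (A ∩ S').card * spinProduct A σ := by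
  simp only [spinProduct, spinAt_flipOn]
  have h : ∀ y ∈ A, (if y ∈ S' then -spinAt y σ else spinAt y σ) =
      (if y ∈ S' then (-1 : ℝ) else 1) * spinAt y σ := by
    intro y _; split_ifs <;> ring
  rw [Finset.prod_congr rfl h, Finset.prod_mul_distrib, Finset.prod_ite, Finset.prod_const,
    Finset.prod_const_one, mul_one, Finset.filter_mem_eq_inter]

omit [DecidableEq ι] in
/-- If every interaction term with nonzero coupling meets `S'` in an even number of sites, then
`Z⟨σ_aσ_z⟩ = 0` for `a ∈ S'`, `z ∉ S'`: the weight is invariant and `σ_aσ_z` is odd under the flip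
of `S'` (the spin-flip symmetry at zero field, Friedli–Velenik 2017, §3.1 / eq. (3.34); at `t = 0`
the set `S'` is decoupled from its complement; the even-intersection form is an elementary
generalisation of the global spin flip, proved here). [folklore] -/
theorem gksSum_spinPair_eq_zero_of_even (K' : ι → ℝ) (S' : Finset Λ) {a z : Λ} (ha : a ∈ S')
    (hz : z ∉ S') (heven : ∀ i ∈ s, K' i = 0 ∨ Even ((C i ∩ S').card)) :
    gksSum s K' C (spinPair a z) = 0 := by
  have hw : ∀ σ, gksWeight s K' C (flipOn S' σ) = gksWeight s K' C σ := by
    intro σ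
    simp only [gksWeight, gksHamiltonian]
    congr 1
    refine Finset.sum_congr rfl fun i hi => ?_
    rw [spinProduct_flipOn]
    rcases heven i hi with h0 | hev
    · simp [h0]
    · rw [hev.neg_one_pow, one_mul]
  have hodd : ∀ σ, spinPair a z (flipOn S' σ) = -spinPair a z σ := by
    intro σ
    simp only [spinPair, spinAt_flipOn, ha, hz, if_true, if_false]
    ring
  unfold gksSum
  have h : ∑ σ, spinPair a z σ * gksWeight s K' C σ =
      ∑ σ, spinPair a z (flipOn S' σ) * gksWeight s K' C (flipOn S' σ) :=
    (Fintype.sum_bijective _ (flipOn_involutive S').bijective _ _ fun _ => rfl).symm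
  have h2 : ∑ σ, spinPair a z (flipOn S' σ) * gksWeight s K' C (flipOn S' σ) =
      -∑ σ, spinPair a z σ * gksWeight s K' C σ := by
    rw [← Finset.sum_neg_distrib]
    exact Finset.sum_congr rfl fun σ _ => by rw [hodd, hw]; ring
  linarith

/-- **Switching on the bonds across a boundary** (the coupling-constant integration behind
Simon's and Lieb's inequalities — Simon 1980, Lieb 1980 — carried out with Lebowitz' inequality,
as in Glimm–Jaffe 1987, §4.2 Prop. 4.2.1 with Cor. 4.3.2–4.3.3): let `ν_{Λ;K}` have couplings
`Kᵢ ≥ 0` on supports of at most two sites, let `B` be a set of bond terms `{xᵢ, yᵢ}`, and let `S'` be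
a set of sites containing `a` but not `z` such that every term outside `B` with nonzero coupling meets `S'` evenly (so
that at `t = 0`, with the bonds of `B` switched off, `⟨σ_aσ_z⟩₀ = 0` by the spin flip of `S'`). Then
`⟨σ_aσ_z⟩_K ≤ ∑_{i∈B} Kᵢ · 2(⟨σ_aσ_{xᵢ}⟩_K⟨σ_{yᵢ}σ_z⟩_K + ⟨σ_aσ_{yᵢ}⟩_K⟨σ_{xᵢ}σ_z⟩_K)`.
Proof: `⟨σ_aσ_z⟩_t` has derivative `∑_{i∈B} Kᵢ Cov_t(σ_aσ_z, σ_{xᵢ}σ_{yᵢ})`, bounded by the right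
side through Lebowitz' covariance bound and Griffiths' monotonicity `⟨·⟩_t ≤ ⟨·⟩_K` (`t ≤ 1`);
integrate over `t ∈ [0,1]` (mean value inequality). [cite: GlimmJaffe1987, Prop. 4.2.1 and Cor. 4.3.2] -/
theorem gksExpect_spinPair_le_boundary_sum (hK : ∀ i ∈ s, 0 ≤ K i) (hC : ∀ i ∈ s, (C i).card ≤ 2)
    (hBs : B ⊆ s) (hB : ∀ i ∈ B, C i = {px i, py i}) (hpxy : ∀ i ∈ B, px i ≠ py i)
    (S' : Finset Λ) {a z : Λ} (ha : a ∈ S') (hz : z ∉ S')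
    (heven : ∀ i ∈ s, i ∉ B → K i = 0 ∨ Even ((C i ∩ S').card)) :
    gksExpect s K C (spinPair a z) ≤
      ∑ i ∈ B, K i * (2 * (gksExpect s K C (spinPair a (px i)) * gksExpect s K C (spinPair (py i) z) +
        gksExpect s K C (spinPair a (py i)) * gksExpect s K C (spinPair (px i) z))) := by
  set M := ∑ i ∈ B, K i * (2 * (gksExpect s K C (spinPair a (px i)) * gksExpect s K C (spinPair (py i) z) +
    gksExpect s K C (spinPair a (py i)) * gksExpect s K C (spinPair (px i) z))) with hM
  set Φ : ℝ → ℝ := fun t => gksExpect s (cplAt K B t) C (spinPair a z) with hΦ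
  have hder : ∀ t, HasDerivAt Φ (∑ i ∈ B, K i *
      (gksExpect s (cplAt K B t) C (fun ω => spinPair a z ω * spinPair (px i) (py i) ω) -
        gksExpect s (cplAt K B t) C (spinPair a z) *
          gksExpect s (cplAt K B t) C (spinPair (px i) (py i)))) t :=
    fun t => hasDerivAt_gksExpect_cplAt_cov s K C B px py hBs hB hpxy (spinPair a z) t
  -- the derivative is bounded by `M` on `[0,1]`
  have hbound : ∀ t, 0 ≤ t → t ≤ 1 → ∑ i ∈ B, K i *
      (gksExpect s (cplAt K B t) C (fun ω => spinPair a z ω * spinPair (px i) (py i) ω) -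
        gksExpect s (cplAt K B t) C (spinPair a z) *
          gksExpect s (cplAt K B t) C (spinPair (px i) (py i))) ≤ M := by
    intro t ht0 ht1
    have hKt := cplAt_nonneg s K B hK ht0
    have habs := abs_cplAt_le s K B hK ht0 ht1
    have hmono : ∀ u v : Λ, gksExpect s (cplAt K B t) C (spinPair u v) ≤ gksExpect s K C (spinPair u v) := by
      intro u v
      rw [spinPair_eq_spinProduct_singleton_symmDiff]
      exact gksExpect_mono_of_abs_le s C habs _
    have hnn : ∀ u v : Λ, 0 ≤ gksExpect s (cplAt K B t) C (spinPair u v) := by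
      intro u v
      rw [spinPair_eq_spinProduct_singleton_symmDiff]
      exact gksExpect_spinProduct_nonneg s _ C hKt _
    have hnnK : ∀ u v : Λ, 0 ≤ gksExpect s K C (spinPair u v) := by
      intro u v
      rw [spinPair_eq_spinProduct_singleton_symmDiff]
      exact gksExpect_spinProduct_nonneg s _ C hK _
    refine Finset.sum_le_sum fun i hi => mul_le_mul_of_nonneg_left ?_ (hK i (hBs hi))
    refine (gksExpect_cov_spinPair_le s (cplAt K B t) C hKt hC a z (px i) (py i)).trans ?_
    refine mul_le_mul_of_nonneg_left (add_le_add ?_ ?_) (by norm_num)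
    · exact mul_le_mul (hmono _ _) (hmono _ _) (hnn _ _) (hnnK _ _)
    · exact mul_le_mul (hmono _ _) (hmono _ _) (hnn _ _) (hnnK _ _)
  have hdiff : Differentiable ℝ Φ := fun t => (hder t).differentiableAt
  have hderiv_le : ∀ t ∈ interior (Set.Icc (0 : ℝ) 1), deriv Φ t ≤ M := by
    intro t ht
    rw [interior_Icc] at ht
    rw [(hder t).deriv]
    exact hbound t ht.1.le ht.2.le
  have hmvt := (convex_Icc (0 : ℝ) 1).image_sub_le_mul_sub_of_deriv_le hdiff.continuous.continuousOn
    hdiff.differentiableOn hderiv_le 0 (Set.left_mem_Icc.2 zero_le_one) 1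
    (Set.right_mem_Icc.2 zero_le_one) zero_le_one
  have h1 : Φ 1 = gksExpect s K C (spinPair a z) := by simp only [hΦ, cplAt_one]
  have h0 : Φ 0 = 0 := by
    simp only [hΦ, cplAt_zero, gksExpect]
    rw [gksSum_spinPair_eq_zero_of_even s C (cplOff K B) S' ha hz ?_, zero_div]
    intro i hi
    by_cases hiB : i ∈ B
    · left; simp [cplOff, hiB]
    · simp only [cplOff, hiB, if_false]
      exact heven i hi hiB
  rw [h1, h0, sub_zero, sub_zero, mul_one] at hmvt
  exact hmvt

end Boundary

/-! ### The finite-volume Ising model on a locally finite graph -/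

section Ising

open MeasureTheory

variable {V : Type*} [DecidableEq V] (G : SimpleGraph V) [G.LocallyFinite]

/-- `⟨σ_uσ_v⟩^{bc}_{Λ;β,h} = ⟨σ_uσ_v⟩_{Λ;K}` for `u, v ∈ Λ` (the two-point companion of
`isingCorr_eq_gksExpect`; Friedli–Velenik 2017, §3.8.1, p. 141). [cite: FriedliVelenik2017, §3.8.1, p. 141] -/
theorem isingTwoPoint_eq_gksExpect (Λ : Finset V) (β h : ℝ) (bc : BoundaryCondition V) {u v : V}
    (hu : u ∈ Λ) (hv : v ∈ Λ) :
    isingTwoPoint G Λ β h bc u v =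
      gksExpect (isingIdx G Λ) (gksCoupling G Λ β h bc) (isingSupp Λ) (spinPair ⟨u, hu⟩ ⟨v, hv⟩) := by
  rw [isingTwoPoint, isingExpect, integral_isingMeasure G Λ β h bc (measurable_spinPair u v), gksExpect,
    gksSum, gksSum, isingPartitionFunction]
  congr 1
  · refine Finset.sum_congr rfl fun τ _ => ?_
    rw [isingWeight_eq_gksWeight, spinPair, spinAt_glue_of_mem τ bc hu, spinAt_glue_of_mem τ bc hv,
      spinPair, mul_comm]
  · refine Finset.sum_congr rfl fun τ _ => ?_
    rw [isingWeight_eq_gksWeight, one_mul]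

/-- The interaction terms of the Ising model are supported on at most two sites. [cite: FriedliVelenik2017, §3.8.1, p. 141] -/
theorem card_isingSupp_le_two (Λ : Finset V) : ∀ i : Sym2 V ⊕ V, (isingSupp Λ i).card ≤ 2 := by
  rintro (e | x)
  · induction e using Sym2.ind with
    | _ a b =>
      calc (isingSupp Λ (.inl s(a, b))).card
          = ((isingSupp Λ (.inl s(a, b))).image Subtype.val).card :=
            (Finset.card_image_of_injective _ Subtype.val_injective).symm
        _ ≤ ({a, b} : Finset V).card := by
            refine Finset.card_le_card fun w hw => ?_
            simp only [Finset.mem_image, isingSupp, Finset.mem_filter, Finset.mem_univ, true_and,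
              Sym2.mem_iff] at hw
            obtain ⟨z, hz, rfl⟩ := hw
            simpa using hz
        _ ≤ 2 := Finset.card_le_two
  · calc (isingSupp Λ (.inr x)).card
        = ((isingSupp Λ (.inr x)).image Subtype.val).card :=
          (Finset.card_image_of_injective _ Subtype.val_injective).symm
      _ ≤ ({x} : Finset V).card := by
          refine Finset.card_le_card fun w hw => ?_
          simp only [Finset.mem_image, isingSupp, Finset.mem_filter, Finset.mem_univ, true_and] at hw
          obtain ⟨z, hz, rfl⟩ := hw
          simpa using hz
      _ ≤ 2 := by simp

/-- For the free and `+` boundary conditions the coupling of an edge inside `Λ` is `β`. [cite: FriedliVelenik2017, §3.8.1, p. 141] -/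
theorem gksCoupling_inl_of_mem_edgesIn {Λ : Finset V} (β h : ℝ) {bc : BoundaryCondition V}
    (hbc : bc = .free ∨ bc = .plus) {e : Sym2 V} (he : e ∈ edgesIn G Λ) :
    gksCoupling G Λ β h bc (.inl e) = β := by
  rcases hbc with rfl | rfl
  · simp only [gksCoupling, interactionEdges_free, he, if_true]
    rw [edgeCoeff_of_mem_edgesIn G _ he, mul_one]
  · exact gksCoupling_plus_inl G β h (edgesIn_subset_edgesTouching Λ he)

/-- The ordered boundary bonds of `S` inside `Λ`: pairs `(x, y)` with `x ∈ S`, `y ∈ Λ ∖ S`, `x ∼ y`. [folklore] -/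
def bdryPairs (S Λ : Finset V) : Finset (V × V) :=
  (S ×ˢ (Λ \ S)).filter fun p => p.2 ∈ G.neighborFinset p.1

/-- Membership in `bdryPairs`. [folklore] -/
theorem mem_bdryPairs {S Λ : Finset V} {p : V × V} :
    p ∈ bdryPairs G S Λ ↔ p.1 ∈ S ∧ p.2 ∈ Λ ∧ p.2 ∉ S ∧ G.Adj p.1 p.2 := by
  simp only [bdryPairs, Finset.mem_filter, Finset.mem_product, Finset.mem_sdiff,
    SimpleGraph.mem_neighborFinset, and_assoc]

/-- `(x, y) ↦ {x, y}` is injective on the ordered boundary bonds (the endpoint in `S` is determined). [folklore] -/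
theorem injOn_bdryPairs (S Λ : Finset V) :
    Set.InjOn (fun p : V × V => (Sum.inl s(p.1, p.2) : Sym2 V ⊕ V)) (bdryPairs G S Λ) := by
  intro p hp q hq h
  simp only [Finset.mem_coe, mem_bdryPairs] at hp hq
  have h' : s(p.1, p.2) = s(q.1, q.2) := Sum.inl_injective h
  rcases Sym2.eq_iff.1 h' with ⟨h1, h2⟩ | ⟨h1, h2⟩
  · exact Prod.ext h1 h2
  · exact absurd (h1 ▸ hp.1) hq.2.2.1

/-- **Switching on the bonds across the boundary of `S` — finite-volume Ising form.** Let `G` be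
locally finite, `Λ` a finite volume with free or `+` boundary condition at `β ≥ 0` and zero field,
and `S ⊆ Λ` a set of sites all of whose neighbours lie in `Λ`. Then for `a ∈ S` and
`z ∈ Λ ∖ S`,
`⟨σ_aσ_z⟩ ≤ 2β ∑_{x∈S} ∑_{y∼x, y∉S} (⟨σ_aσ_x⟩⟨σ_yσ_z⟩ + ⟨σ_aσ_y⟩⟨σ_xσ_z⟩)`
(all expectations in `Λ`). This is the Ising-model boundary inequality obtained from Lebowitz'
inequality by integrating the couplings of the boundary bonds of `S` from `0` to `β` (at coupling
`0` the spin flip of `S` gives `⟨σ_aσ_z⟩ = 0`); it is a variant, with the constant `2β J` in place of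
`tanh(βJ)` and `⟨σ_aσ_x⟩_Λ` in place of `⟨σ_aσ_x⟩_S`, of Simon's inequality (Simon 1980, eq. (1)
of Lieb 1980) and of the Lieb / Duminil-Copin–Tassion improvement, and serves the same purpose
(a finite-boundary criterion for the decay of `⟨σ₀σ_z⟩`). [cite: GlimmJaffe1987, Prop. 4.2.1 and Cor. 4.3.2] -/
theorem isingTwoPoint_le_boundary_sum {Λ S : Finset V} (hSΛ : S ⊆ Λ)
    (hN : ∀ x ∈ S, ∀ y, G.Adj x y → y ∈ Λ) {β : ℝ} (hβ : 0 ≤ β) {bc : BoundaryCondition V}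
    (hbc : bc = .free ∨ bc = .plus) {a z : V} (ha : a ∈ S) (hzS : z ∉ S) (hzΛ : z ∈ Λ) :
    isingTwoPoint G Λ β 0 bc a z ≤
      2 * β * ∑ x ∈ S, ∑ y ∈ (G.neighborFinset x).filter (· ∉ S),
        (isingTwoPoint G Λ β 0 bc a x * isingTwoPoint G Λ β 0 bc y z +
          isingTwoPoint G Λ β 0 bc a y * isingTwoPoint G Λ β 0 bc x z) := by
  classical
  have haΛ : a ∈ Λ := hSΛ ha
  -- the gks data
  set s := isingIdx G Λ with hs
  set K := gksCoupling G Λ β 0 bc with hKdef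
  set C := isingSupp Λ with hCdef
  set T := bdryPairs G S Λ with hT
  set emb : V × V → Sym2 V ⊕ V := fun p => Sum.inl s(p.1, p.2) with hemb
  set B := T.image emb with hB
  -- endpoints of the bonds of `B`
  have hex : ∀ i, i ∈ B → ∃ p, p ∈ T ∧ emb p = i := fun i hi => by
    simpa only [hB, Finset.mem_image] using hi
  haveI : Nonempty (V × V) := ⟨(a, a)⟩
  choose! pf hpfT hpf using hex
  set px : Sym2 V ⊕ V → ↥Λ := fun i => if h : (pf i).1 ∈ Λ then ⟨(pf i).1, h⟩ else ⟨a, haΛ⟩ with hpx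
  set py : Sym2 V ⊕ V → ↥Λ := fun i => if h : (pf i).2 ∈ Λ then ⟨(pf i).2, h⟩ else ⟨a, haΛ⟩ with hpy
  have hpfT' : ∀ i ∈ B, (pf i).1 ∈ S ∧ (pf i).2 ∈ Λ ∧ (pf i).2 ∉ S ∧ G.Adj (pf i).1 (pf i).2 :=
    fun i hi => (mem_bdryPairs G).1 (hpfT i hi)
  have hpx_val : ∀ i ∈ B, ((px i : ↥Λ) : V) = (pf i).1 := by
    intro i hi; simp only [hpx, dif_pos (hSΛ (hpfT' i hi).1)]
  have hpy_val : ∀ i ∈ B, ((py i : ↥Λ) : V) = (pf i).2 := by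
    intro i hi; simp only [hpy, dif_pos (hpfT' i hi).2.1]
  -- edges of B are edges inside Λ
  have hTedge : ∀ p ∈ T, s(p.1, p.2) ∈ edgesIn G Λ := by
    intro p hp
    obtain ⟨h1, h2, _, hadj⟩ := (mem_bdryPairs G).1 hp
    rw [mem_edgesIn_iff]
    refine ⟨(SimpleGraph.mem_edgeSet G).2 hadj, fun w hw => ?_⟩
    rcases Sym2.mem_iff.1 hw with rfl | rfl
    · exact hSΛ h1
    · exact h2
  have hBs : B ⊆ s := by
    intro i hi
    obtain ⟨p, hp, rfl⟩ := Finset.mem_image.1 hi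
    simp only [hs, isingIdx, hemb, Finset.inl_mem_disjSum]
    exact edgesIn_subset_edgesTouching Λ (hTedge p hp)
  -- hypotheses of the gks theorem
  have hK : ∀ i ∈ s, 0 ≤ K i := gksCoupling_nonneg G hβ le_rfl hbc
  have hC : ∀ i ∈ s, (C i).card ≤ 2 := fun i _ => card_isingSupp_le_two Λ i
  have hBC : ∀ i ∈ B, C i = {px i, py i} := by
    intro i hi
    obtain ⟨h1, h2, h3, hadj⟩ := hpfT' i hi
    have hi' : i = Sum.inl s((pf i).1, (pf i).2) := (hpf i hi).symm
    ext w
    rw [Finset.mem_insert, Finset.mem_singleton, Subtype.ext_iff, Subtype.ext_iff, hpx_val i hi,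
      hpy_val i hi]
    conv_lhs => rw [hi']
    simp only [hCdef, isingSupp, Finset.mem_filter, Finset.mem_univ, true_and, Sym2.mem_iff]
  have hpxy : ∀ i ∈ B, px i ≠ py i := by
    intro i hi h
    have h' := congrArg Subtype.val h
    rw [hpx_val i hi, hpy_val i hi] at h'
    obtain ⟨h1, _, h3, _⟩ := hpfT' i hi
    exact h3 (h' ▸ h1)
  -- the flipped region and evenness
  set S' : Finset ↥Λ := inVol Λ S with hS'
  have haS' : (⟨a, haΛ⟩ : ↥Λ) ∈ S' := by simpa [hS'] using ha
  have hzS' : (⟨z, hzΛ⟩ : ↥Λ) ∉ S' := by simpa [hS'] using hzS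
  have heven : ∀ i ∈ s, i ∉ B → K i = 0 ∨ Even ((C i ∩ S').card) := by
    rintro (e | x) hi hiB
    · right
      have he : e ∈ edgesTouching G Λ := by simpa [hs, isingIdx] using hi
      have he' := (mem_edgesTouching_iff.1 he).1
      induction e using Sym2.ind with
      | _ u v =>
        have huv : G.Adj u v := (SimpleGraph.mem_edgeSet G).1 he'
        -- if exactly one endpoint is in S the edge is in B
        have hnot : ¬ (u ∈ S ∧ v ∉ S) := by
          rintro ⟨hu, hv⟩
          apply hiB
          refine Finset.mem_image.2 ⟨(u, v), (mem_bdryPairs G).2 ⟨hu, hN u hu v huv, hv, huv⟩, rfl⟩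
        have hnot' : ¬ (v ∈ S ∧ u ∉ S) := by
          rintro ⟨hv, hu⟩
          apply hiB
          refine Finset.mem_image.2 ⟨(v, u), (mem_bdryPairs G).2 ⟨hv, hN v hv u huv.symm, hu, huv.symm⟩, ?_⟩
          simp only [hemb, Sym2.eq_swap]
        -- compute the intersection
        have hinter : C (.inl s(u, v)) ∩ S' = Finset.univ.filter fun w : ↥Λ =>
            ((w : V) = u ∨ (w : V) = v) ∧ (w : V) ∈ S := by
          ext w
          simp only [hCdef, isingSupp, hS', mem_inVol, Finset.mem_inter, Finset.mem_filter,
            Finset.mem_univ, true_and, Sym2.mem_iff]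
        rw [hinter]
        by_cases hu : u ∈ S
        · have hv : v ∈ S := by by_contra hv; exact hnot ⟨hu, hv⟩
          -- both endpoints in S: the set is {u, v} (as elements of Λ)
          have huΛ : u ∈ Λ := hSΛ hu
          have hvΛ : v ∈ Λ := hSΛ hv
          have hset : (Finset.univ.filter fun w : ↥Λ => ((w : V) = u ∨ (w : V) = v) ∧ (w : V) ∈ S) =
              {⟨u, huΛ⟩, ⟨v, hvΛ⟩} := by
            ext w
            simp only [Finset.mem_filter, Finset.mem_univ, true_and, Finset.mem_insert,
              Finset.mem_singleton, Subtype.ext_iff]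
            constructor
            · rintro ⟨h | h, _⟩
              · exact Or.inl h
              · exact Or.inr h
            · rintro (h | h)
              · exact ⟨Or.inl h, h ▸ hu⟩
              · exact ⟨Or.inr h, h ▸ hv⟩
          rw [hset, Finset.card_pair]
          · exact even_two
          · intro h
            exact G.ne_of_adj huv (congrArg Subtype.val h)
        · have hv : v ∉ S := fun hv => hnot' ⟨hv, hu⟩
          have hset : (Finset.univ.filter fun w : ↥Λ => ((w : V) = u ∨ (w : V) = v) ∧ (w : V) ∈ S) = ∅ := by
            ext w
            simp only [Finset.mem_filter, Finset.mem_univ, true_and, Finset.notMem_empty, iff_false,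
              not_and]
            rintro (h | h) <;> rw [h]
            · exact hu
            · exact hv
          rw [hset, Finset.card_empty]
          exact ⟨0, rfl⟩
    · left
      simp [hKdef, gksCoupling]
  -- apply the gks theorem
  have hmain := gksExpect_spinPair_le_boundary_sum s K C B px py hK hC hBs hBC hpxy S' haS' hzS' heven
  rw [← isingTwoPoint_eq_gksExpect G Λ β 0 bc haΛ hzΛ] at hmain
  refine hmain.trans (le_of_eq ?_)
  -- reindex the sum over B by the ordered boundary bonds
  rw [hB, Finset.sum_image (injOn_bdryPairs G S Λ)]
  have hterm : ∀ p ∈ T, K (emb p) * (2 * (gksExpect s K C (spinPair ⟨a, haΛ⟩ (px (emb p))) *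
      gksExpect s K C (spinPair (py (emb p)) ⟨z, hzΛ⟩) +
      gksExpect s K C (spinPair ⟨a, haΛ⟩ (py (emb p))) * gksExpect s K C (spinPair (px (emb p)) ⟨z, hzΛ⟩))) =
      2 * β * (isingTwoPoint G Λ β 0 bc a p.1 * isingTwoPoint G Λ β 0 bc p.2 z +
        isingTwoPoint G Λ β 0 bc a p.2 * isingTwoPoint G Λ β 0 bc p.1 z) := by
    intro p hp
    have hi : emb p ∈ B := Finset.mem_image_of_mem emb hp
    have hpfp : pf (emb p) = p := injOn_bdryPairs G S Λ (hpfT _ hi) hp (hpf _ hi)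
    obtain ⟨h1, h2, _, _⟩ := (mem_bdryPairs G).1 hp
    have hpx1 : px (emb p) = ⟨p.1, hSΛ h1⟩ := Subtype.ext (by rw [hpx_val _ hi, hpfp])
    have hpy1 : py (emb p) = ⟨p.2, h2⟩ := Subtype.ext (by rw [hpy_val _ hi, hpfp])
    rw [hpx1, hpy1, ← isingTwoPoint_eq_gksExpect G Λ β 0 bc haΛ (hSΛ h1),
      ← isingTwoPoint_eq_gksExpect G Λ β 0 bc h2 hzΛ, ← isingTwoPoint_eq_gksExpect G Λ β 0 bc haΛ h2,
      ← isingTwoPoint_eq_gksExpect G Λ β 0 bc (hSΛ h1) hzΛ]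
    rw [show K (emb p) = β from gksCoupling_inl_of_mem_edgesIn G β 0 hbc (hTedge p hp)]
    ring
  rw [Finset.sum_congr rfl hterm, ← Finset.mul_sum]
  congr 1
  -- T = bdryPairs as an iterated sum
  rw [hT, bdryPairs, Finset.sum_filter, Finset.sum_product]
  refine Finset.sum_congr rfl fun x hx => ?_
  rw [Finset.sum_filter]
  -- {y ∈ Λ \ S | y ∼ x} versus {y ∼ x | y ∉ S}
  rw [← Finset.sum_filter, ← Finset.sum_filter]
  apply Finset.sum_congr _ (fun _ _ => rfl)
  ext y
  simp only [Finset.mem_filter, Finset.mem_sdiff, SimpleGraph.mem_neighborFinset]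
  constructor
  · rintro ⟨⟨_, hyS⟩, hadj⟩; exact ⟨hadj, hyS⟩
  · rintro ⟨hadj, hyS⟩; exact ⟨⟨hN x hx y hadj, hyS⟩, hadj⟩

end Ising

end Literature.Probability.LatticeModels
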